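import Mathlib
import Literature.Barriers.PneNP.TSPExtensionComplexityKaibelWeltge
import Literature.Barriers.PneNP.TSPExtensionComplexityHyperplaneBound
import Summits.ValiantsHypothesis.ValiantsHypothesis.Theorems.FifoMatchingNNDivisionHardLocatedRowsColumnCoupled
import Summits.ValiantsHypothesis.ValiantsHypothesis.Theorems.FifoMatchingGridCorShadowOfCliqueFace

/-!
# ShadowConstRead41 — the anchored star–clique tilt: every passenger with CONSTANT OFF-DIAGONAL SHADOW on a large minor is
# DECIDED by the law of record C′ = `ExactPencilLaw` (val-idea-41 g3, W6-R1 successor step; crux `FifoMatching.NNDivisionHard`,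
# stmt-ValiantsHypothesis-21181; kernel of `ShadowConstRead41.md`)

After N22 (crit-9 g2 ✓ p679540 `locatedPencilLaw_false`; independently this seat's `PermTiltBlind41.lean` K1–K3) the located law of record is
C′ = `ExactPencilLaw := exactTilted.Law` (38 g2 / 40 g5): rows `udRow a + flat W ≤ 1 + h_COR(W)` with the EXACT support value of the tilt.
This file proves, in the Law's own currency (literal conclusion `T c n < r`, the `HasEFOfSize` budget unused):

★★★ `exactTilted_law_on_offDiagConst` — if the passenger list `q : Fin (K+1) → ℝ^{n×n}` has CONSTANT OFF-DIAGONAL SHADOW on a set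
`M ⊆ [n]` (`q_j(i,m) = q_{j'}(i,m)` for all `j, j'` and all `i ≠ m` in `M`; `OffDiagConst M q`) with `n + 4 ≤ 2|M|`, then the body of
`exactTilted.Law` holds at `(n, K, q, r)` for `n ≥ n₀(c)`.
★★★ `exactTilted_law_holds_on_diagonal` — every DIAGONAL passenger list `q_j = flat (diagonal (D j))` (`Q^Π_λ` for every `λ`, every diagonal
design / cube / zonotope) is decided by C′, `n ≥ max n₀ 4` — ONE a-agnostic mechanism, no pin, no rearrangement, no passenger-specific maximiser.
★★★ `exactTilted_body_on_offDiagConst_polylog` — POLYLOG MINORS SUFFICE: `|M| ≥ 2(log₂ n + c)^c + 6` already decides, for EVERY `n`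
(budget-scale rate lemma `T_lt_of_block_polylog`, no `n ≤ 2g`): an enemy of C′ has non-constant off-diagonal shadow on every polylog minor.
§3 (rev 3) ★★ THE JUNK-TOLERANT COUNT — `three_pow_le_of_pattern` (KW needs zeros only on the `|a∩b| = 1` cells, positivity on the
disjoint cells; everything else is junk), ★★ `sc_pattern_block` / ★★★ `exactTilted_body_of_partialCommonMax`: a PARTIAL common maximiser
per column (`ScPartialCommonMax q a₀ c α`, `|α| ≥ 2(log₂ n + c)^c + 4`) already decides under C′, for every `n`;
`scPartialCommonMax_of_offDiagConst`: the shadow-constant class is inside.  ENEMY SPEC (E18): on every polylog anchored configuration some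
column's `|a'∩b'| = 1` rows have NO common maximiser among the passenger's points.
§4 (rev 5) ★★★ DECIDED IN THE FLAT SOCKET, BY NAME (`concl_of_lawBody exactTilted`, ✓ `…LocatedRowsColumnCoupled`): `offDiagConst_decided`
and `partialCommonMax_decided` (`HasEFOfSize (corPolytope n + conv q) r → T c n < r`, EVERY `n`), `diagonal_decided` (eventually in `n`) — the
shape a `CoreLaw` binder of the line consumes.

MECHANISM (§2–§4).  The ANCHORED STAR–CLIQUE TILT `scTilt a₀ A (i,m) = [i = a₀][m ∈ A] − [i ∈ A][m ∈ A] + [i = m][i ∈ A]` (off-diagonal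
support inside `({a₀} ∪ A)²` when `a₀ ∉ A`) has `⟨flat (scTilt a₀ A), x_b⟩ = [a₀ ∈ b]·k − k² + k`, `k = |A ∩ b|` (`scTilt_dot`), hence is
`≤ 1` on every vertex (`scTilt_dot_le_one`) with equality at `{a₀, c}` for `c ∈ A`: `h_COR(scTilt a₀ A) = 1` (`hCOR_scTilt`).  Rows
`R(a') = ({a₀}, scTilt a₀ (a' ∪ {c}))` (clique part FROZEN at the anchor; `a' ⊆ α = M ∖ {a₀,c}`), columns `({a₀} ∪ b', j₀)`: the COR part of the
exact slack is `2 − (1 + 2k − k²) = (1 − |a' ∩ b'|)²` — the unique-disjointness pattern manufactured INSIDE THE TILT — and the passenger part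
vanishes at ONE index `j₀` common to all rows, because the tilt does not see a shadow-constant passenger (`scTilt_dot_const`) so
`⟨ρ(R a'), q_j⟩ = ⟨udRow {a₀}, q_j⟩ + κ(a')` (`common_index`).  Then the tree's law-currency block count `three_pow_le_of_block`
(Kaibel–Weltge) gives `3^{|M|−2} ≤ (r+1)·2^{|M|−2}` (`sc_block`) and the rate lemma `T_lt_of_block'` the literal `T c n < r`.

MEANING.  (i) For the W6 enemy hunt (card `anchored-rows-kill-relaxations` (E16)): an enemy of C′ must have NON-CONSTANT off-diagonal shadow
on EVERY minor `M` with `2|M| ≥ n + 4`; with (E13) `OffDiagShadow41.permPassenger_three_pow_le` (constant shadow on a minor ⇒ `COR + Q` hard)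
shadow-constant passengers leave the located programme on BOTH sides.  (ii) It recovers 40 g5's ★★★ `exactTilted_law_holds_on_qPerm` for ALL
diagonal passengers at once.  (iii) Under the refuted BOX rhs (`entryTilted`) the same rows have `β = 1 + 2|A|` and no block — consistent with N22.
§1 (rev 4): the frame `T`, `RowFamily`, `RowFamily.Law`, `three_pow_le_of_block`, `two_pow_half_mul_le`, `T_lt_of_block'`, `hCOR`, `le_hCOR`,
`exists_eq_hCOR`, `flat_le_hCOR`, `exactTilted`, `ExactPencilLaw` is IMPORTED BY NAME from the landed Theorems modules (`…Theorems.FifoMatching.LocatedRows`,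
✓ p680125 / p680583 / `…LocatedRowsPinExposed`): every theorem here is about the TREE's `exactTilted` / `ExactPencilLaw` (revs 1–3 carried verbatim copies).
§5 (rev 6) ★★★★ ANTIPODAL TWIN ROWS.  A SECOND mechanism, orthogonal to the star–clique tilt: for twins `ι₁ ι₂ : Fin k ↪ Fin n` the
exact-tilted row `(ι₁ a, −udMat(ι₂ a))` has direction `udRow(ι₁a) − udRow(ι₂a)`, rhs `(|a|−1)²`, and COR-slack `(1 − |a∩b|)²` on the face
`{ι₁b ∪ ι₂ univ}` — a PURE UDISJ block of size `k − 2` for EVERY «twin-blind» passenger (all twin rows constant on it: passenger part ≡ 0;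
`twin_block`, `twinBlind_decided` — flat socket, BY NAME).  Every interaction matrix `I_{u,v}` of 38 g2 §10 is ⊥ to every twin row
(`twinRow_dot_interMat`), so every passenger list with differences in `span{I_{u,v}}` — `Q_II` with ANY base point and ANY (also unbudgeted)
vertex list — is DECIDED (`interSpan_decided`; rate: block `n/2 − 2`).  RECORD NOTE: 38 g2 rev 10 §12 `cor_add_sparseCube_decided`
(≈00:24Z 08-29, seven minutes earlier) decides `Q_II` too, as a SPARSE-GENERATOR cube via together faces (block `⌊n/7⌋`); §5 is independent
and its class is incomparable: twin-blind allows DENSE generators (arbitrary `ι₁ × ι₂` blocks, any equal symmetrised diagonal twin blocks),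
needs no pinning / avoidance, and is not a cube hypothesis.  ENEMY SPEC (E19): the direction space of an enemy of C′ must have UNEQUAL
symmetrised diagonal twin blocks for every twin pair covering all but `≤ 1` point.  §5c (rev 7, (E20)): the explicit EDGE TEST
`twinRow_dot_flat` (a twin row reads only the difference of the two diagonal twin blocks through `udMat a`), `twinBlind_of_blocks` /
`blocks_decided` (equal symmetrised twin blocks of all differences ⇒ decided), and the JUNK-TOLERANT twin block `TwinPCM` / `twin_pattern_block` /
`twinPCM_decided` (a partial common maximiser of the twin rows per column suffices).
HONEST FRAMING: theorems about the located LAW C′ on a CLASS of passengers; nothing here is a statement about COR-VIRTUAL, the crux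
`NNDivisionHard` (OPEN) or VP ≠ VNP (NOT proved).

Rev 12 (≈01:25Z 08-29): §5g the GENERIC FORM of (E21) — `exists_separating_pin` (pairwise distinct `S × S` blocks ⇒ the moment pin
`t ^ ecode(x,y)` at `t = 1 + Σ|roots|` separates all listed points) and ★★★★★ `distinctS_decided` («C′ holds on every passenger whose listed
points have pairwise distinct `S × S` blocks for the twin half `S`»; an enemy must have two points agreeing on `S × S` for EVERY near-half `S`).
C′ OPEN; 21181 OPEN; VP ≠ VNP NOT proved.

Rev 13 (g4, ≈02:00Z 08-29; pen 01:25:19Z (2), crit-9 V#101b): §5h SPECIES TEN ⊆ CLASS P — `sTop_pinExposed` (a nonneg `S × S` pin with a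
strict unique top, `2|S| ≤ n`, IS `LocatedRows.PinExposed` data via the λ-scaled pin `flat (c • P)`) and `distinctS_pinExposed` (twin frame +
pairwise distinct `S × S` blocks ⇒ `PinExposed`).  Census consequence: rows TEN / s-top of the line's residual are INSIDE the landed class
`PinExposed` (⊆ `PinLocated` of X₁₈) by name — no new disjunct.  (The law-level collapse C′ ⟺ COR-VIRTUAL is `ExactIsVirtual41.lean`.)
C′ OPEN; 21181 OPEN; VP ≠ VNP NOT proved.
-/

set_option linter.dupNamespace false

namespace Summit.ValiantsHypothesis.ValiantsHypothesis.Cruxes.NNDivisionHard.ValIdea41.ShadowConstRead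

open Matrix Finset
open Literature.Barriers.PneNP (HasEFOfSize three_pow_le_card_mul_two_pow_of_cover_univ)
open Literature.Combinatorics.Optimization.FixedSizePsdRank (Cube bvec flat vecOuter corPolytope flat_dotProduct_vecOuter
  flat_dotProduct_le_of_mem_corPolytope)
open Summit.ValiantsHypothesis.ValiantsHypothesis.Theorems.FifoMatching.XcDivision
  (udInd udPt udRow udMat udInd_apply udInd_sq udInd_inter ud_data udRow_dotProduct_flat_diagonal flat_dotProduct_flat)
open Summit.ValiantsHypothesis.ValiantsHypothesis.Theorems.FifoMatching.GridCorShadow (four_T_lt_two_pow)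
open Summit.ValiantsHypothesis.ValiantsHypothesis.Theorems.FifoMatching.LocatedRows
  (T RowFamily three_pow_le_of_block two_pow_half_mul_le T_lt_of_block' hCOR le_hCOR exists_eq_hCOR flat_le_hCOR exactTilted ExactPencilLaw
    concl_of_lawBody CorVirtualHardN corVirtualHardN_of_exactPencilLaw PinExposed)
open scoped Pointwise

/-! ## §1 The frame — IMPORTED BY NAME (rev 4) from the landed Theorems modules

`T`, `RowFamily`, `RowFamily.Law`, `three_pow_le_of_block`, `hCOR`, `le_hCOR`, `exists_eq_hCOR`, `flat_le_hCOR`, `exactTilted`, `ExactPencilLaw`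
(✓ p680125 `Theorems/FifoMatchingNNDivisionHardRowFamilies.lean`), `two_pow_half_mul_le` (✓ p680583 `…LocatedRowsPairPencil.lean`) and
`T_lt_of_block'` (`…LocatedRowsPinExposed.lean`), all in `Summit.ValiantsHypothesis.ValiantsHypothesis.Theorems.FifoMatching.LocatedRows` — so every
theorem below concludes the TREE's `exactTilted` law body BY NAME (revs 1–3 carried verbatim copies).  Two small helpers stay local. -/

section ExactCurrency
variable {n : ℕ}

theorem sum_mul_udInd (f : Fin n → ℝ) (b : Finset (Fin n)) : ∑ j, f j * udInd b j = ∑ j ∈ b, f j := by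
  classical
  simp only [udInd_apply, mul_ite, mul_one, mul_zero]
  rw [Finset.sum_ite_mem, Finset.univ_inter]

/-- `⟨flat C, x_b x_bᵀ⟩ = Σ_{p,q ∈ b} C_{pq}`. -/
theorem flat_dotProduct_udPt_eq (C : Matrix (Fin n) (Fin n) ℝ) (b : Finset (Fin n)) :
    flat C ⬝ᵥ udPt b = ∑ p ∈ b, ∑ q ∈ b, C p q := by
  rw [show udPt b = vecOuter n (udInd b) from rfl, flat_dotProduct_vecOuter]
  have h1 : ∀ p, ∑ q, C p q * (udInd b p * udInd b q) = (∑ q ∈ b, C p q) * udInd b p := fun p => by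
    rw [← sum_mul_udInd (fun q => C p q) b, Finset.sum_mul]
    exact Finset.sum_congr rfl fun q _ => by ring
  simp_rw [h1]
  exact sum_mul_udInd (fun p => ∑ q ∈ b, C p q) b


end ExactCurrency

/-! ## §2 The anchored star–clique tilt -/

section StarClique
variable {n : ℕ}

/-- `⟨flat C, v⟩ = Σ_{i,m} C_{im} v_{(i,m)}` for an arbitrary vector `v ∈ ℝ^{n²}`. -/
theorem flat_dotProduct_eq (C : Matrix (Fin n) (Fin n) ℝ) (v : Fin (n * n) → ℝ) :
    flat C ⬝ᵥ v = ∑ i, ∑ m, C i m * v (finProdFinEquiv (i, m)) := by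
  unfold flat dotProduct
  rw [← finProdFinEquiv.sum_comp]
  simp only [Equiv.symm_apply_apply]
  rw [Fintype.sum_prod_type]

/-- ★ THE ANCHORED STAR–CLIQUE TILT at anchor `a₀` over the set `A`:
`scTilt a₀ A (i,m) = [i = a₀][m ∈ A] − [i ∈ A][m ∈ A] + [i = m][i ∈ A]` — the `a₀`-row indicator of `A` minus the OFF-diagonal clique of `A`. -/
def scTilt (a₀ : Fin n) (A : Finset (Fin n)) : Matrix (Fin n) (Fin n) ℝ := fun i m =>
  udInd {a₀} i * udInd A m - (udInd A i * udInd A m - if i = m then udInd A i else 0)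

/-- ★ the value formula: `⟨flat (scTilt a₀ A), x_b⟩ = |{a₀} ∩ b|·k − k² + k`, `k = |A ∩ b|`. -/
theorem scTilt_dot (a₀ : Fin n) (A b : Finset (Fin n)) :
    flat (scTilt a₀ A) ⬝ᵥ udPt b = ((({a₀} : Finset (Fin n)) ∩ b).card : ℝ) * ((A ∩ b).card : ℝ)
      - ((A ∩ b).card : ℝ) * ((A ∩ b).card : ℝ) + ((A ∩ b).card : ℝ) := by
  rw [show udPt b = vecOuter n (udInd b) from rfl, flat_dotProduct_vecOuter]
  have e1 : ∑ i, ∑ j, (udInd {a₀} i * udInd A j) * (udInd b i * udInd b j)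
      = (∑ i, udInd {a₀} i * udInd b i) * (∑ j, udInd A j * udInd b j) := by
    rw [Finset.sum_mul_sum]
    exact Finset.sum_congr rfl fun i _ => Finset.sum_congr rfl fun j _ => by ring
  have e2 : ∑ i, ∑ j, (udInd A i * udInd A j) * (udInd b i * udInd b j)
      = (∑ i, udInd A i * udInd b i) * (∑ j, udInd A j * udInd b j) := by
    rw [Finset.sum_mul_sum]
    exact Finset.sum_congr rfl fun i _ => Finset.sum_congr rfl fun j _ => by ring
  have e3 : ∑ i, ∑ j, (if i = j then udInd A i else 0) * (udInd b i * udInd b j) = ∑ i, udInd A i * udInd b i := by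
    refine Finset.sum_congr rfl fun i _ => ?_
    have : ∀ j, (if i = j then udInd A i else 0) * (udInd b i * udInd b j)
        = if i = j then udInd A i * (udInd b i * udInd b j) else 0 := fun j => by
      split_ifs <;> ring
    simp only [this, Finset.sum_ite_eq, Finset.mem_univ, if_true]
    rw [udInd_sq]
  have split : ∀ i j, scTilt a₀ A i j * (udInd b i * udInd b j)
      = (udInd {a₀} i * udInd A j) * (udInd b i * udInd b j)
        - (udInd A i * udInd A j) * (udInd b i * udInd b j)
        + (if i = j then udInd A i else 0) * (udInd b i * udInd b j) := fun i j => by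
    simp only [scTilt]; ring
  simp only [split, Finset.sum_add_distrib, Finset.sum_sub_distrib]
  rw [e1, e2, e3, udInd_inter, udInd_inter]

/-- on the face `b ∋ a₀`: `⟨scTilt, x_b⟩ = 2k − k²`. -/
theorem scTilt_dot_of_mem (a₀ : Fin n) (A : Finset (Fin n)) {b : Finset (Fin n)} (h : a₀ ∈ b) :
    flat (scTilt a₀ A) ⬝ᵥ udPt b = 2 * ((A ∩ b).card : ℝ) - ((A ∩ b).card : ℝ) * ((A ∩ b).card : ℝ) := by
  rw [scTilt_dot, Finset.singleton_inter_of_mem h, Finset.card_singleton]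
  push_cast
  ring

/-- off the face: `⟨scTilt, x_b⟩ = k − k²`. -/
theorem scTilt_dot_of_not_mem (a₀ : Fin n) (A : Finset (Fin n)) {b : Finset (Fin n)} (h : a₀ ∉ b) :
    flat (scTilt a₀ A) ⬝ᵥ udPt b = ((A ∩ b).card : ℝ) - ((A ∩ b).card : ℝ) * ((A ∩ b).card : ℝ) := by
  rw [scTilt_dot, Finset.singleton_inter_of_notMem h, Finset.card_empty]
  push_cast
  ring

/-- ★ validity with the exact value `1`: `⟨scTilt, x_b⟩ ≤ 1` on every vertex of `COR(n)`. -/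
theorem scTilt_dot_le_one (a₀ : Fin n) (A b : Finset (Fin n)) : flat (scTilt a₀ A) ⬝ᵥ udPt b ≤ 1 := by
  have hk : ((A ∩ b).card : ℝ) ≤ ((A ∩ b).card : ℝ) * ((A ∩ b).card : ℝ) := by
    exact_mod_cast Nat.le_mul_self _
  by_cases h : a₀ ∈ b
  · rw [scTilt_dot_of_mem a₀ A h]
    nlinarith [sq_nonneg (((A ∩ b).card : ℝ) - 1)]
  · rw [scTilt_dot_of_not_mem a₀ A h]
    linarith

/-- ★ `h_COR(scTilt a₀ A) = 1` as soon as `A ∌ a₀` has an element `c` (the value `1` is attained at `x_{{a₀,c}}`). -/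
theorem hCOR_scTilt (a₀ : Fin n) {A : Finset (Fin n)} (ha : a₀ ∉ A) {c : Fin n} (hc : c ∈ A) :
    hCOR (scTilt a₀ A) = 1 := by
  apply le_antisymm
  · exact Finset.sup'_le _ _ fun b _ => scTilt_dot_le_one a₀ A b
  · have h := le_hCOR (scTilt a₀ A) ({a₀, c} : Finset (Fin n))
    rw [scTilt_dot_of_mem a₀ A (by simp)] at h
    have hk : A ∩ ({a₀, c} : Finset (Fin n)) = {c} := by
      ext x
      simp only [Finset.mem_inter, Finset.mem_insert, Finset.mem_singleton]
      constructor
      · rintro ⟨hx, rfl | rfl⟩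
        · exact absurd hx ha
        · rfl
      · rintro rfl; exact ⟨hc, Or.inr rfl⟩
    rw [hk, Finset.card_singleton] at h
    norm_num at h
    exact h

/-- the support of the tilt: off-diagonal, inside `({a₀} ∪ A) × A`. -/
theorem scTilt_support (a₀ : Fin n) {A : Finset (Fin n)} (ha : a₀ ∉ A) {i m : Fin n} (h : scTilt a₀ A i m ≠ 0) :
    (i = a₀ ∨ i ∈ A) ∧ m ∈ A ∧ i ≠ m := by
  by_contra hcon
  apply h
  have e : ∀ x : Fin n, udInd ({a₀} : Finset (Fin n)) x = if x = a₀ then 1 else 0 := fun x => by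
    rw [udInd_apply]; simp
  simp only [scTilt, e, udInd_apply]
  by_cases h3 : m ∈ A
  · by_cases h4 : i = m
    · subst h4
      have hia : i ≠ a₀ := fun h' => ha (h' ▸ h3)
      simp [h3, hia]
    · have hi1 : i ≠ a₀ := fun h' => hcon ⟨Or.inl h', h3, h4⟩
      have hi2 : i ∉ A := fun h' => hcon ⟨Or.inr h', h3, h4⟩
      simp [h3, h4, hi1, hi2]
  · by_cases h4 : i = m
    · subst h4; simp [h3]
    · simp [h3, h4]

/-- ★ CONSTANT OFF-DIAGONAL SHADOW on `M`: every off-diagonal coordinate inside `M × M` of the passenger list is independent of the index. -/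
def OffDiagConst {K : ℕ} (M : Finset (Fin n)) (q : Fin (K + 1) → (Fin (n * n) → ℝ)) : Prop :=
  ∀ j j' : Fin (K + 1), ∀ i m : Fin n, i ∈ M → m ∈ M → i ≠ m →
    q j (finProdFinEquiv (i, m)) = q j' (finProdFinEquiv (i, m))

/-- every DIAGONAL passenger list has constant (zero) off-diagonal shadow on the whole of `[n]`. -/
theorem offDiagConst_of_diagonal {K : ℕ} (D : Fin (K + 1) → Fin n → ℝ) :
    OffDiagConst (Finset.univ : Finset (Fin n)) (fun j => flat (Matrix.diagonal (D j))) := by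
  intro j j' i m _ _ him
  simp [flat, Matrix.diagonal_apply_ne _ him]

/-- ★ the tilt does not see a shadow-constant passenger: `⟨flat (scTilt a₀ A), q_j⟩` is independent of `j` when `{a₀} ∪ A ⊆ M`. -/
theorem scTilt_dot_const {K : ℕ} {M : Finset (Fin n)} {q : Fin (K + 1) → (Fin (n * n) → ℝ)} (hq : OffDiagConst M q)
    (a₀ : Fin n) {A : Finset (Fin n)} (ha : a₀ ∉ A) (ha₀ : a₀ ∈ M) (hA : A ⊆ M) (j j' : Fin (K + 1)) :
    flat (scTilt a₀ A) ⬝ᵥ q j = flat (scTilt a₀ A) ⬝ᵥ q j' := by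
  rw [flat_dotProduct_eq, flat_dotProduct_eq]
  refine Finset.sum_congr rfl fun i _ => Finset.sum_congr rfl fun m _ => ?_
  by_cases h0 : scTilt a₀ A i m = 0
  · rw [h0, zero_mul, zero_mul]
  · obtain ⟨hi, hm, him⟩ := scTilt_support a₀ ha h0
    have hiM : i ∈ M := by
      rcases hi with rfl | hi
      · exact ha₀
      · exact hA hi
    rw [hq j j' i m hiM (hA hm) him]

/-- a COMMON maximising index: if the row values split as `u_j + κ_a`, any admissible row-max function is attained at one index for all rows. -/
theorem common_index {R J : Type*} (u : J → ℝ) (κ : R → ℝ) (mrow : R → ℝ) (r₀ : R)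
    (h1 : ∀ a j, u j + κ a ≤ mrow a) (h2 : ∀ a, ∃ j, u j + κ a = mrow a) :
    ∃ j₀, ∀ a, u j₀ + κ a = mrow a := by
  obtain ⟨j₀, hj₀⟩ := h2 r₀
  refine ⟨j₀, fun a => le_antisymm (h1 a j₀) ?_⟩
  obtain ⟨j, hj⟩ := h2 a
  have : u j ≤ u j₀ := by have := h1 r₀ j; linarith
  linarith

/-- the clique row of the single anchor evaluates to `1` on the face `b ∋ a₀`. -/
theorem udRow_singleton_dot (a₀ : Fin n) {b : Finset (Fin n)} (h : a₀ ∈ b) :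
    udRow ({a₀} : Finset (Fin n)) ⬝ᵥ udPt b = 1 := by
  have key := (ud_data n).2.2.1 {a₀} b
  rw [Finset.singleton_inter_of_mem h, Finset.card_singleton] at key
  norm_num at key
  linarith

/-- ★★ THE EMBEDDED BLOCK.  For a shadow-constant passenger on `M ∋ a₀, c` (`a₀ ≠ c`), ANY admissible row maxima `mrow` and ANY nonnegative
factorization of the exact-law located slack of `(COR(n), q)` through `Option (Fin r)`: `3^{|M|−2} ≤ (r+1)·2^{|M|−2}`. -/
theorem sc_block {K r : ℕ} (q : Fin (K + 1) → (Fin (n * n) → ℝ)) (M : Finset (Fin n)) (hq : OffDiagConst M q)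
    {a₀ c : Fin n} (ha₀ : a₀ ∈ M) (hc : c ∈ M) (hac : a₀ ≠ c)
    (mrow : exactTilted.A n → ℝ) (hm1 : ∀ a j, exactTilted.ρ n a ⬝ᵥ q j ≤ mrow a)
    (hm2 : ∀ a, ∃ j, exactTilted.ρ n a ⬝ᵥ q j = mrow a)
    (U : exactTilted.A n → Option (Fin r) → ℝ) (V : Finset (Fin n) × Fin (K + 1) → Option (Fin r) → ℝ)
    (hU : ∀ a i, 0 ≤ U a i) (hV : ∀ p i, 0 ≤ V p i)
    (hfac : ∀ a b j, (exactTilted.β n a + mrow a) - exactTilted.ρ n a ⬝ᵥ (udPt b + q j) = ∑ i, U a i * V (b, j) i) :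
    3 ^ (M.card - 2) ≤ (r + 1) * 2 ^ (M.card - 2) := by
  classical
  -- the free index set α = M ∖ {a₀, c}
  set α : Finset (Fin n) := (M.erase a₀).erase c with hαdef
  have hcα : c ∈ M.erase a₀ := Finset.mem_erase.mpr ⟨hac.symm, hc⟩
  have hαcard : α.card = M.card - 2 := by
    rw [hαdef, Finset.card_erase_of_mem hcα, Finset.card_erase_of_mem ha₀]
    omega
  have hαM : ∀ x ∈ α, x ∈ M ∧ x ≠ a₀ ∧ x ≠ c := fun x hx => by
    simp only [hαdef, Finset.mem_erase] at hx
    exact ⟨hx.2.2, hx.2.1, hx.1⟩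
  let emb : Finset ↥α → Finset (Fin n) := fun s => s.map (Function.Embedding.subtype _)
  have hemb : ∀ (s : Finset ↥α), ∀ x ∈ emb s, x ∈ M ∧ x ≠ a₀ ∧ x ≠ c := by
    intro s x hx
    obtain ⟨y, -, rfl⟩ := Finset.mem_map.mp hx
    exact hαM _ y.2
  -- rows and their tilt sets
  let Aset : Finset ↥α → Finset (Fin n) := fun a' => insert c (emb a')
  have hA_a₀ : ∀ a', a₀ ∉ Aset a' := fun a' h => by
    rcases Finset.mem_insert.mp h with h | h
    · exact hac h
    · exact (hemb a' a₀ h).2.1 rfl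
  have hA_c : ∀ a', c ∈ Aset a' := fun a' => Finset.mem_insert_self _ _
  have hA_M : ∀ a', Aset a' ⊆ M := fun a' x hx => by
    rcases Finset.mem_insert.mp hx with rfl | h
    · exact hc
    · exact (hemb a' x h).1
  let row : Finset ↥α → exactTilted.A n := fun a' => (({a₀} : Finset (Fin n)), scTilt a₀ (Aset a'))
  let colset : Finset ↥α → Finset (Fin n) := fun b' => insert a₀ (emb b')
  have hρ : ∀ a', exactTilted.ρ n (row a') = udRow ({a₀} : Finset (Fin n)) + flat (scTilt a₀ (Aset a')) := fun _ => rfl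
  have hβ : ∀ a', exactTilted.β n (row a') = 1 + hCOR (scTilt a₀ (Aset a')) := fun _ => rfl
  -- the passenger part splits as u_j + κ(a')
  have hsplit : ∀ a' j, exactTilted.ρ n (row a') ⬝ᵥ q j
      = udRow ({a₀} : Finset (Fin n)) ⬝ᵥ q j + flat (scTilt a₀ (Aset a')) ⬝ᵥ q 0 := by
    intro a' j
    rw [hρ, add_dotProduct, scTilt_dot_const hq a₀ (hA_a₀ a') ha₀ (hA_M a') j 0]
  obtain ⟨j₀, hj₀⟩ := common_index (fun j => udRow ({a₀} : Finset (Fin n)) ⬝ᵥ q j)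
    (fun a' => flat (scTilt a₀ (Aset a')) ⬝ᵥ q 0) (fun a' => mrow (row a')) (∅ : Finset ↥α)
    (fun a' j => by rw [← hsplit]; exact hm1 (row a') j)
    (fun a' => by obtain ⟨j, hj⟩ := hm2 (row a'); exact ⟨j, by rw [← hsplit]; exact hj⟩)
  -- intersections on the block
  have hinter : ∀ a' b' : Finset ↥α, Aset a' ∩ colset b' = emb (a' ∩ b') := by
    intro a' b'
    have hc_col : c ∉ colset b' := fun h => by
      rcases Finset.mem_insert.mp h with h | h
      · exact hac h.symm
      · exact (hemb b' c h).2.2 rfl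
    show insert c (emb a') ∩ insert a₀ (emb b') = emb (a' ∩ b')
    rw [Finset.insert_inter_of_notMem hc_col, Finset.inter_insert_of_notMem (fun h => (hemb a' a₀ h).2.1 rfl)]
    exact (Finset.map_inter _ _).symm
  -- the block identity
  have key := three_pow_le_of_block U V hU hV row (fun b' => (colset b', j₀)) (fun a' b' => ?_)
  · have h1 : Fintype.card ↥α = M.card - 2 := by rw [Fintype.card_coe, hαcard]
    have h2 : Fintype.card (Option (Fin r)) = r + 1 := by simp
    rw [h1, h2] at key
    exact key
  · rw [← hfac (row a') (colset b') j₀, dotProduct_add, hsplit a' j₀, ← hj₀ a', hβ, hCOR_scTilt a₀ (hA_a₀ a') (hA_c a'),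
      hρ, add_dotProduct, udRow_singleton_dot a₀ (Finset.mem_insert_self _ _),
      scTilt_dot_of_mem a₀ _ (Finset.mem_insert_self _ _), hinter, Finset.card_map]
    ring

/-- ★★★ **C′ = `ExactPencilLaw` HOLDS ON EVERY PASSENGER WITH CONSTANT OFF-DIAGONAL SHADOW ON A LARGE MINOR** — `exactTilted.Law` with its
passenger quantifier restricted to `OffDiagConst M q`, `n + 4 ≤ 2|M|`; literal conclusion `T c n < r`, the `HasEFOfSize` budget unused. -/
theorem exactTilted_law_on_offDiagConst : ∀ c₀ : ℕ, ∃ n₀ : ℕ, ∀ n ≥ n₀,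
    ∀ (K : ℕ) (q : Fin (K + 1) → (Fin (n * n) → ℝ)) (r : ℕ),
    (∃ M : Finset (Fin n), n + 4 ≤ 2 * M.card ∧ OffDiagConst M q) →
    HasEFOfSize (convexHull ℝ (Set.range q)) r →
    ∀ m : exactTilted.A n → ℝ, (∀ a j, exactTilted.ρ n a ⬝ᵥ q j ≤ m a) → (∀ a, ∃ j, exactTilted.ρ n a ⬝ᵥ q j = m a) →
    ∀ (U : exactTilted.A n → Option (Fin r) → ℝ) (V : Finset (Fin n) × Fin (K + 1) → Option (Fin r) → ℝ),
      (∀ a i, 0 ≤ U a i) → (∀ p i, 0 ≤ V p i) →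
      (∀ a b j, (exactTilted.β n a + m a) - exactTilted.ρ n a ⬝ᵥ (udPt b + q j) = ∑ i, U a i * V (b, j) i) →
      T c₀ n < r := by
  intro c₀
  obtain ⟨n₀, hn₀⟩ := T_lt_of_block' c₀
  refine ⟨n₀, fun n hn K q r hM _ m hm1 hm2 U V hU hV hfac => ?_⟩
  obtain ⟨M, hMcard, hq⟩ := hM
  have h2 : 1 < M.card := by omega
  obtain ⟨a₀, ha₀, c, hc, hac⟩ := Finset.one_lt_card.mp h2
  have hblock := sc_block q M hq ha₀ hc hac m hm1 hm2 U V hU hV hfac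
  exact hn₀ n hn (M.card - 2) r (by omega) hblock

/-- ★★★ **EVERY DIAGONAL PASSENGER IS DECIDED BY C′** (`Q^Π_λ` for every `λ`, every diagonal design / cube / zonotope): `exactTilted.Law`
with its passenger quantifier specialised to diagonal lists `q_j = flat (diagonal (D j))`, literal conclusion `T c n < r`. -/
theorem exactTilted_law_holds_on_diagonal : ∀ c₀ : ℕ, ∃ n₀ : ℕ, ∀ n ≥ n₀,
    ∀ (K : ℕ) (D : Fin (K + 1) → Fin n → ℝ) (r : ℕ),
    HasEFOfSize (convexHull ℝ (Set.range fun j => flat (Matrix.diagonal (D j)))) r →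
    ∀ m : exactTilted.A n → ℝ, (∀ a j, exactTilted.ρ n a ⬝ᵥ flat (Matrix.diagonal (D j)) ≤ m a) →
      (∀ a, ∃ j, exactTilted.ρ n a ⬝ᵥ flat (Matrix.diagonal (D j)) = m a) →
    ∀ (U : exactTilted.A n → Option (Fin r) → ℝ) (V : Finset (Fin n) × Fin (K + 1) → Option (Fin r) → ℝ),
      (∀ a i, 0 ≤ U a i) → (∀ p i, 0 ≤ V p i) →
      (∀ a b j, (exactTilted.β n a + m a) - exactTilted.ρ n a ⬝ᵥ (udPt b + flat (Matrix.diagonal (D j))) = ∑ i, U a i * V (b, j) i) →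
      T c₀ n < r := by
  intro c₀
  obtain ⟨n₀, hn₀⟩ := exactTilted_law_on_offDiagConst c₀
  refine ⟨max n₀ 4, fun n hn K D r hEF m hm1 hm2 U V hU hV hfac => ?_⟩
  have hn4 : 4 ≤ n := le_of_max_le_right hn
  exact hn₀ n (le_of_max_le_left hn) K (fun j => flat (Matrix.diagonal (D j))) r
    ⟨Finset.univ, by rw [Finset.card_univ, Fintype.card_fin]; omega, offDiagConst_of_diagonal D⟩ hEF m hm1 hm2 U V hU hV hfac

/-! ### Polylogarithmic minors suffice (a budget-scale rate lemma, no `n ≤ 2g`) -/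

/-- ★ RATE AT THE BUDGET SCALE: `2·(log₂ n + c)^c + 4 ≤ g` and `3^g ≤ (r+1)·2^g` give `T c n < r` — for EVERY `n` (no `n₀`). -/
theorem T_lt_of_block_polylog (c n g r : ℕ) (hg : 2 * (Nat.log 2 n + c) ^ c + 4 ≤ g)
    (hr : 3 ^ g ≤ (r + 1) * 2 ^ g) : T c n < r := by
  have hpow : 2 ^ (g / 2) * 2 ^ g ≤ (r + 1) * 2 ^ g := (two_pow_half_mul_le g).trans hr
  have hle : 2 ^ (g / 2) ≤ r + 1 := Nat.le_of_mul_le_mul_right hpow (Nat.pos_of_ne_zero (by positivity))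
  have hexp : (Nat.log 2 n + c) ^ c + 2 ≤ g / 2 := by omega
  have hT4 : 2 ^ ((Nat.log 2 n + c) ^ c + 2) ≤ 2 ^ (g / 2) := Nat.pow_le_pow_right (by norm_num) hexp
  have hT : 1 ≤ 2 ^ ((Nat.log 2 n + c) ^ c) := Nat.one_le_two_pow
  unfold T
  rw [pow_add] at hT4
  norm_num at hT4
  omega

/-- ★★★ **POLYLOG MINORS SUFFICE**: a passenger with constant off-diagonal shadow on ANY set `M` with
`|M| ≥ 2·(log₂ n + c)^c + 6` is decided by C′ at `(n, K, q, r)` — for every `n`, literal `T c n < r`.  Hence an ENEMY of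
`ExactPencilLaw` at budget `c` must have NON-CONSTANT off-diagonal shadow on EVERY principal minor of polylogarithmic size `2(log₂ n + c)^c + 6`. -/
theorem exactTilted_body_on_offDiagConst_polylog (c₀ n K : ℕ) (q : Fin (K + 1) → (Fin (n * n) → ℝ)) (r : ℕ)
    (M : Finset (Fin n)) (hM : 2 * (Nat.log 2 n + c₀) ^ c₀ + 6 ≤ M.card) (hq : OffDiagConst M q)
    (m : exactTilted.A n → ℝ) (hm1 : ∀ a j, exactTilted.ρ n a ⬝ᵥ q j ≤ m a) (hm2 : ∀ a, ∃ j, exactTilted.ρ n a ⬝ᵥ q j = m a)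
    (U : exactTilted.A n → Option (Fin r) → ℝ) (V : Finset (Fin n) × Fin (K + 1) → Option (Fin r) → ℝ)
    (hU : ∀ a i, 0 ≤ U a i) (hV : ∀ p i, 0 ≤ V p i)
    (hfac : ∀ a b j, (exactTilted.β n a + m a) - exactTilted.ρ n a ⬝ᵥ (udPt b + q j) = ∑ i, U a i * V (b, j) i) :
    T c₀ n < r := by
  have h2 : 1 < M.card := by omega
  obtain ⟨a₀, ha₀, c, hc, hac⟩ := Finset.one_lt_card.mp h2
  have hblock := sc_block q M hq ha₀ hc hac m hm1 hm2 U V hU hV hfac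
  exact T_lt_of_block_polylog c₀ n (M.card - 2) r (by omega) hblock

/-! ## §3 ★★ THE JUNK-TOLERANT COUNT (40 g5 §5c's «count junk-tolerantly», typed): KW needs ZEROS ONLY ON THE `|a ∩ b| = 1` CELLS

`three_pow_le_of_block` asks for the PURE pattern `(1 − |a∩b|)²` on the whole block; Kaibel–Weltge's rectangle argument
(`three_pow_le_card_mul_two_pow_of_cover_univ`) uses only (Z) slack `= 0` on the cells `|a ∩ b| = 1` and (P) slack `> 0` on the
DISJOINT cells — the cells with `|a ∩ b| ≥ 2` are FREE, and positive passenger junk on disjoint cells is HARMLESS (`three_pow_le_of_pattern`).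
For the anchored star–clique rows the COR part of the exact slack on the column `{a₀} ∪ b'` is `(1 − |a'∩b'|)²` (`sc_corSlack`) and the
passenger part `m(a') − ⟨ρ(a'), q_j⟩` is `≥ 0`, so the located read needs exactly: for every column set `b' ⊆ α` ONE listed index `j(b')`
maximising (among the listed points) the rows `a'` with `|a' ∩ b'| = 1` — a PARTIAL common maximiser PER COLUMN (`ScPartialCommonMax`)
instead of (E17)'s global one (`scPartialCommonMax_of_offDiagConst`: (E17) ⊂ (E18)).  ENEMY SPEC (E18): an enemy of C′ at budget `c`
has, on EVERY anchored configuration `(a₀, c, α)` with `|α| ≥ 2(log₂ n + c)^c + 4`, a column set `b' ⊆ α` whose `|a'∩b'| = 1` rows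
admit NO common maximiser among its points (for a cube: some generator on which these directions have BOTH strict signs). -/

/-- ★ PATTERN (junk-tolerant) VERSION of the block count: zeros on the `|a ∩ b| = 1` cells and positive entries on the disjoint cells
of a nonnegatively factorised block already give `3^{|α|} ≤ |ι|·2^{|α|}` (entries on cells with `|a ∩ b| ≥ 2` are arbitrary). -/
theorem three_pow_le_of_pattern {R C ι α : Type*} [Fintype ι] [Fintype α] [DecidableEq α]
    (U : R → ι → ℝ) (V : C → ι → ℝ) (hU : ∀ ρ i, 0 ≤ U ρ i) (hV : ∀ κ i, 0 ≤ V κ i)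
    (row : Finset α → R) (col : Finset α → C)
    (hzero : ∀ a b : Finset α, (a ∩ b).card = 1 → ∑ i, U (row a) i * V (col b) i = 0)
    (hpos : ∀ a b : Finset α, Disjoint a b → 0 < ∑ i, U (row a) i * V (col b) i) :
    3 ^ Fintype.card α ≤ Fintype.card ι * 2 ^ Fintype.card α := by
  classical
  have key := three_pow_le_card_mul_two_pow_of_cover_univ (α := α) (Finset.univ : Finset ι)
    (fun i => {a : Finset α | 0 < U (row a) i}) (fun i => {b : Finset α | 0 < V (col b) i}) ?_ ?_
  · rwa [Finset.card_univ] at key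
  · intro i _ a ha b hb h1
    have ha' : 0 < U (row a) i := ha
    have hb' : 0 < V (col b) i := hb
    have hsum := hzero a b h1
    have hle : U (row a) i * V (col b) i ≤ ∑ j, U (row a) j * V (col b) j :=
      Finset.single_le_sum (f := fun j => U (row a) j * V (col b) j) (fun j _ => mul_nonneg (hU _ j) (hV _ j))
        (Finset.mem_univ i)
    have hprod : 0 < U (row a) i * V (col b) i := mul_pos ha' hb'
    linarith
  · intro a b hab
    have h := hpos a b hab
    by_contra hne
    have hi : ∀ i, ¬ (0 < U (row a) i ∧ 0 < V (col b) i) := fun i h2 => hne ⟨i, Finset.mem_univ i, h2.1, h2.2⟩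
    have hzero' : ∑ i, U (row a) i * V (col b) i = 0 := by
      refine Finset.sum_eq_zero fun i _ => ?_
      by_cases hu : 0 < U (row a) i
      · have hv : ¬ 0 < V (col b) i := fun hv => hi i ⟨hu, hv⟩
        rw [le_antisymm (not_lt.mp hv) (hV _ i), mul_zero]
      · rw [le_antisymm (not_lt.mp hu) (hU _ i), zero_mul]
    linarith

/-- the embedding of a finite set of the index subtype `↥α` into `Fin n`. -/
def embα (α : Finset (Fin n)) (s : Finset ↥α) : Finset (Fin n) := s.map (Function.Embedding.subtype _)

theorem mem_of_mem_embα {α : Finset (Fin n)} {s : Finset ↥α} {x : Fin n} (hx : x ∈ embα α s) : x ∈ α := by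
  obtain ⟨y, -, rfl⟩ := Finset.mem_map.mp hx
  exact y.2

theorem embα_inter (α : Finset (Fin n)) (s t : Finset ↥α) : embα α s ∩ embα α t = embα α (s ∩ t) :=
  (Finset.map_inter _ _).symm

theorem card_embα (α : Finset (Fin n)) (s : Finset ↥α) : (embα α s).card = s.card := Finset.card_map _

/-- the anchored star–clique DIRECTION of the row indexed by `a' ⊆ α`: clique part `{a₀}`, tilt `scTilt a₀ ({c} ∪ a')`. -/
noncomputable def scDir (a₀ c : Fin n) (α : Finset (Fin n)) (a' : Finset ↥α) : Fin (n * n) → ℝ :=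
  udRow ({a₀} : Finset (Fin n)) + flat (scTilt a₀ (insert c (embα α a')))

/-- ★ THE HYPOTHESIS OF THE JUNK-TOLERANT READ: for every column set `b' ⊆ α`, ONE listed passenger index maximises, among the
listed points, every anchored star–clique direction `scDir a₀ c α a'` with `|a' ∩ b'| = 1`. -/
def ScPartialCommonMax {K : ℕ} (q : Fin (K + 1) → (Fin (n * n) → ℝ)) (a₀ c : Fin n) (α : Finset (Fin n)) : Prop :=
  ∀ b' : Finset ↥α, ∃ j : Fin (K + 1), ∀ a' : Finset ↥α, (a' ∩ b').card = 1 →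
    ∀ j' : Fin (K + 1), scDir a₀ c α a' ⬝ᵥ q j' ≤ scDir a₀ c α a' ⬝ᵥ q j

/-- the COR part of the exact slack of an anchored star–clique row on the column `{a₀} ∪ b'` IS the unique-disjointness entry. -/
theorem sc_corSlack {a₀ c : Fin n} (α : Finset (Fin n)) (ha₀ : a₀ ∉ α) (hcα : c ∉ α) (hac : a₀ ≠ c) (a' b' : Finset ↥α) :
    (1 + hCOR (scTilt a₀ (insert c (embα α a')))) - scDir a₀ c α a' ⬝ᵥ udPt (insert a₀ (embα α b'))
      = (1 - ((a' ∩ b').card : ℝ)) ^ 2 := by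
  classical
  have hA_a₀ : a₀ ∉ insert c (embα α a') := fun h => by
    rcases Finset.mem_insert.mp h with h | h
    · exact hac h
    · exact ha₀ (mem_of_mem_embα h)
  have hc_col : c ∉ insert a₀ (embα α b') := fun h => by
    rcases Finset.mem_insert.mp h with h | h
    · exact hac h.symm
    · exact hcα (mem_of_mem_embα h)
  have hinter : insert c (embα α a') ∩ insert a₀ (embα α b') = embα α (a' ∩ b') := by
    rw [Finset.insert_inter_of_notMem hc_col, Finset.inter_insert_of_notMem (fun h => ha₀ (mem_of_mem_embα h))]
    exact embα_inter α a' b'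
  unfold scDir
  rw [hCOR_scTilt a₀ hA_a₀ (Finset.mem_insert_self _ _), add_dotProduct, udRow_singleton_dot a₀ (Finset.mem_insert_self _ _),
    scTilt_dot_of_mem a₀ _ (Finset.mem_insert_self _ _), hinter, card_embα]
  ring

/-- ★★ THE JUNK-TOLERANT LOCATED BLOCK.  For ANY passenger list `q`, if ONE anchored configuration `(a₀, c, α)` (`a₀, c ∉ α`, `a₀ ≠ c`)
has a partial common maximiser per column (`ScPartialCommonMax`), then ANY admissible row maxima and ANY nonnegative factorization of the
exact-law located slack of `(COR(n), q)` through `Option (Fin r)` give `3^{|α|} ≤ (r+1)·2^{|α|}` — zeros on the `|a'∩b'| = 1` cells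
(COR part `0`, passenger part `0` by maximality), positive entries `≥ 1` on the disjoint cells, the rest is junk and ignored. -/
theorem sc_pattern_block {K r : ℕ} (q : Fin (K + 1) → (Fin (n * n) → ℝ)) {a₀ c : Fin n} (α : Finset (Fin n))
    (ha₀ : a₀ ∉ α) (hcα : c ∉ α) (hac : a₀ ≠ c) (hpcm : ScPartialCommonMax q a₀ c α)
    (mrow : exactTilted.A n → ℝ) (hm1 : ∀ a j, exactTilted.ρ n a ⬝ᵥ q j ≤ mrow a)
    (hm2 : ∀ a, ∃ j, exactTilted.ρ n a ⬝ᵥ q j = mrow a)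
    (U : exactTilted.A n → Option (Fin r) → ℝ) (V : Finset (Fin n) × Fin (K + 1) → Option (Fin r) → ℝ)
    (hU : ∀ a i, 0 ≤ U a i) (hV : ∀ p i, 0 ≤ V p i)
    (hfac : ∀ a b j, (exactTilted.β n a + mrow a) - exactTilted.ρ n a ⬝ᵥ (udPt b + q j) = ∑ i, U a i * V (b, j) i) :
    3 ^ α.card ≤ (r + 1) * 2 ^ α.card := by
  classical
  let row : Finset ↥α → exactTilted.A n := fun a' => (({a₀} : Finset (Fin n)), scTilt a₀ (insert c (embα α a')))
  have hρ : ∀ a', exactTilted.ρ n (row a') = scDir a₀ c α a' := fun _ => rfl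
  have hβ : ∀ a', exactTilted.β n (row a') = 1 + hCOR (scTilt a₀ (insert c (embα α a'))) := fun _ => rfl
  unfold ScPartialCommonMax at hpcm
  choose jc hjc using hpcm
  -- the exact slack splits into its COR part (the UDISJ entry) and its nonnegative passenger part
  have hslack : ∀ a' b', ∑ i, U (row a') i * V (insert a₀ (embα α b'), jc b') i
      = (1 - ((a' ∩ b').card : ℝ)) ^ 2 + (mrow (row a') - scDir a₀ c α a' ⬝ᵥ q (jc b')) := by
    intro a' b'
    rw [← hfac, hρ, hβ, dotProduct_add, ← sc_corSlack α ha₀ hcα hac a' b']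
    ring
  have key := three_pow_le_of_pattern U V hU hV row (fun b' => (insert a₀ (embα α b'), jc b')) ?_ ?_
  · have h1 : Fintype.card ↥α = α.card := Fintype.card_coe α
    have h2 : Fintype.card (Option (Fin r)) = r + 1 := by simp
    rw [h1, h2] at key
    exact key
  · intro a' b' h1
    obtain ⟨j, hj⟩ := hm2 (row a')
    have hle := hjc b' a' h1 j
    have hge := hm1 (row a') (jc b')
    rw [hρ] at hj hge
    have hk : ((a' ∩ b').card : ℝ) = 1 := by exact_mod_cast h1
    rw [hslack, hk]
    have h0 : mrow (row a') - scDir a₀ c α a' ⬝ᵥ q (jc b') = 0 := by linarith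
    rw [h0]
    norm_num
  · intro a' b' hab
    have hge := hm1 (row a') (jc b')
    rw [hρ] at hge
    have hk : ((a' ∩ b').card : ℝ) = 0 := by
      rw [Finset.disjoint_iff_inter_eq_empty.mp hab, Finset.card_empty, Nat.cast_zero]
    rw [hslack, hk]
    have h0 : 0 ≤ mrow (row a') - scDir a₀ c α a' ⬝ᵥ q (jc b') := by linarith
    norm_num
    linarith

/-- ★★★ **C′ ON THE JUNK-TOLERANT CLASS, literal `T c n < r`, for EVERY `n`**: a partial common maximiser per column on ONE anchored
configuration `(a₀, c, α)` with `|α| ≥ 2(log₂ n + c)^c + 4` already decides the passenger under `ExactPencilLaw`'s rows. -/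
theorem exactTilted_body_of_partialCommonMax (c₀ n K : ℕ) (q : Fin (K + 1) → (Fin (n * n) → ℝ)) (r : ℕ)
    {a₀ c : Fin n} (α : Finset (Fin n)) (ha₀ : a₀ ∉ α) (hcα : c ∉ α) (hac : a₀ ≠ c)
    (hα : 2 * (Nat.log 2 n + c₀) ^ c₀ + 4 ≤ α.card) (hpcm : ScPartialCommonMax q a₀ c α)
    (m : exactTilted.A n → ℝ) (hm1 : ∀ a j, exactTilted.ρ n a ⬝ᵥ q j ≤ m a) (hm2 : ∀ a, ∃ j, exactTilted.ρ n a ⬝ᵥ q j = m a)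
    (U : exactTilted.A n → Option (Fin r) → ℝ) (V : Finset (Fin n) × Fin (K + 1) → Option (Fin r) → ℝ)
    (hU : ∀ a i, 0 ≤ U a i) (hV : ∀ p i, 0 ≤ V p i)
    (hfac : ∀ a b j, (exactTilted.β n a + m a) - exactTilted.ρ n a ⬝ᵥ (udPt b + q j) = ∑ i, U a i * V (b, j) i) :
    T c₀ n < r :=
  T_lt_of_block_polylog c₀ n α.card r hα (sc_pattern_block q α ha₀ hcα hac hpcm m hm1 hm2 U V hU hV hfac)

/-- (E17) ⊂ (E18): a passenger with constant off-diagonal shadow on `M ⊇ {a₀, c} ∪ α` has a GLOBAL common maximiser of all anchored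
star–clique directions (the maximiser of the anchor coordinate `q_j(a₀,a₀)`), in particular partial ones. -/
theorem scPartialCommonMax_of_offDiagConst {K : ℕ} {q : Fin (K + 1) → (Fin (n * n) → ℝ)} {M : Finset (Fin n)}
    (hq : OffDiagConst M q) {a₀ c : Fin n} (ha₀ : a₀ ∈ M) (hc : c ∈ M) (hac : a₀ ≠ c) (α : Finset (Fin n))
    (hαM : α ⊆ M) (ha₀α : a₀ ∉ α) : ScPartialCommonMax q a₀ c α := by
  classical
  obtain ⟨j₀, -, hj₀⟩ := Finset.exists_max_image Finset.univ (fun j => udRow ({a₀} : Finset (Fin n)) ⬝ᵥ q j)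
    Finset.univ_nonempty
  intro b'
  refine ⟨j₀, fun a' _ j' => ?_⟩
  have hA_a₀ : a₀ ∉ insert c (embα α a') := fun h => by
    rcases Finset.mem_insert.mp h with h | h
    · exact hac h
    · exact ha₀α (mem_of_mem_embα h)
  have hA_M : insert c (embα α a') ⊆ M := fun x hx => by
    rcases Finset.mem_insert.mp hx with rfl | h
    · exact hc
    · exact hαM (mem_of_mem_embα h)
  unfold scDir
  rw [add_dotProduct, add_dotProduct, scTilt_dot_const hq a₀ hA_a₀ ha₀ hA_M j' j₀]
  have := hj₀ j' (Finset.mem_univ _)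
  linarith

/-! ## §4 ★★★ DECIDED, IN THE FLAT SOCKET (xc currency, BY NAME via the tree's pointwise Yannakakis `concl_of_lawBody`)

The shape a `CoreLaw` binder of the line consumes: `HasEFOfSize (COR(n) + conv q) r → T c n < r`.  No `n₀` for the two polylog classes. -/

/-- ★★★ **SHADOW-CONSTANT PASSENGERS ARE DECIDED** (flat socket, every `n`): constant off-diagonal shadow on a minor `M` with
`|M| ≥ 2(log₂ n + c)^c + 6` and an EF of `COR(n) + conv q` of size `r` force `T c n < r`. -/
theorem offDiagConst_decided (c₀ n K : ℕ) (q : Fin (K + 1) → (Fin (n * n) → ℝ)) (r : ℕ) (M : Finset (Fin n))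
    (hM : 2 * (Nat.log 2 n + c₀) ^ c₀ + 6 ≤ M.card) (hq : OffDiagConst M q)
    (hR : HasEFOfSize (corPolytope n + convexHull ℝ (Set.range q)) r) : T c₀ n < r :=
  concl_of_lawBody exactTilted q
    (fun m hm1 hm2 U V hU hV hfac => exactTilted_body_on_offDiagConst_polylog c₀ n K q r M hM hq m hm1 hm2 U V hU hV hfac) hR

/-- ★★★ **EVERY DIAGONAL PASSENGER IS DECIDED** (flat socket, eventually in `n`): `Q^Π_λ` for every `λ`, every diagonal design / cube /
zonotope — an EF of `COR(n) + conv{flat (diagonal (D j))}` of size `r` forces `T c n < r`. -/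
theorem diagonal_decided (c₀ : ℕ) : ∃ n₀ : ℕ, ∀ n ≥ n₀, ∀ (K : ℕ) (D : Fin (K + 1) → Fin n → ℝ) (r : ℕ),
    HasEFOfSize (corPolytope n + convexHull ℝ (Set.range fun j => flat (Matrix.diagonal (D j)))) r → T c₀ n < r := by
  classical
  obtain ⟨n₀, hn₀⟩ := T_lt_of_block' c₀
  refine ⟨max n₀ 4, fun n hn K D r hR => ?_⟩
  have hn4 : 4 ≤ n := le_of_max_le_right hn
  refine concl_of_lawBody exactTilted (fun j => flat (Matrix.diagonal (D j))) (fun m hm1 hm2 U V hU hV hfac => ?_) hR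
  have hcard : 1 < (Finset.univ : Finset (Fin n)).card := by rw [Finset.card_univ, Fintype.card_fin]; omega
  obtain ⟨a₀, -, c, -, hac⟩ := Finset.one_lt_card.mp hcard
  have hblock := sc_block (fun j => flat (Matrix.diagonal (D j))) Finset.univ (offDiagConst_of_diagonal D)
    (Finset.mem_univ a₀) (Finset.mem_univ c) hac m hm1 hm2 U V hU hV hfac
  rw [Finset.card_univ, Fintype.card_fin] at hblock
  exact hn₀ n (le_of_max_le_left hn) (n - 2) r (by omega) hblock

/-- ★★★ **THE JUNK-TOLERANT CLASS IS DECIDED** (flat socket, every `n`): a partial common maximiser per column on ONE anchored configuration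
`(a₀, c, α)` with `|α| ≥ 2(log₂ n + c)^c + 4` and an EF of `COR(n) + conv q` of size `r` force `T c n < r`. -/
theorem partialCommonMax_decided (c₀ n K : ℕ) (q : Fin (K + 1) → (Fin (n * n) → ℝ)) (r : ℕ) {a₀ c : Fin n} (α : Finset (Fin n))
    (ha₀ : a₀ ∉ α) (hcα : c ∉ α) (hac : a₀ ≠ c) (hα : 2 * (Nat.log 2 n + c₀) ^ c₀ + 4 ≤ α.card) (hpcm : ScPartialCommonMax q a₀ c α)
    (hR : HasEFOfSize (corPolytope n + convexHull ℝ (Set.range q)) r) : T c₀ n < r :=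
  concl_of_lawBody exactTilted q
    (fun m hm1 hm2 U V hU hV hfac => exactTilted_body_of_partialCommonMax c₀ n K q r α ha₀ hcα hac hα hpcm m hm1 hm2 U V hU hV hfac) hR

end StarClique

/-! ## §5 ★★★★ ANTIPODAL TWIN ROWS: the «twin-blind» class — containing 38 g2's wave-7 seed `Q_II` — is DECIDED by C′

Two disjoint embeddings `ι₁ ι₂ : Fin k ↪ Fin n` (twins; `n ≤ 2k + 1`).  The exact-tilted row with clique part `ι₁ a` and tilt `−udMat (ι₂ a)`
has direction `twinRow a = udRow (ι₁ a) − udRow (ι₂ a)` and right-hand side `1 + hCOR(−udMat (ι₂ a)) = (|a| − 1)²` (`|a| ≥ 2`).  On the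
coordinate face `{ι₁ b ∪ ι₂ univ}` its COR-slack is `(|a| − 1)² − [1 − (1 − |a∩b|)²] − [(1 − |a|)² − 1] = (1 − |a∩b|)²`: a PURE UDISJ block of
size `k − 2` (rows `a ⊇ {z₁, z₂}` keep `|a| ≥ 2`).  A passenger on which every twin row is CONSTANT (`TwinBlind`) contributes NOTHING to the
located slack (passenger part `≡ 0`), so `3^{k−2} ≤ (r+1)·2^{k−2}` (`twin_block`) and `T c n < r` eventually (`twinBlind_decided`, flat socket,
BY NAME via `concl_of_lawBody exactTilted`).  Every interaction matrix `I_{u,v} = Eˢ_{ι₁u ι₁v} − Eˢ_{ι₁u ι₂v} − Eˢ_{ι₂u ι₁v} + Eˢ_{ι₂u ι₂v}`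
(38 g2 `ExactPencil38` §10) is ORTHOGONAL to every twin row (the two diagonal blocks cancel, block-diagonal rows do not see the off-diagonal
blocks: `twinRow_dot_interMat`), hence every passenger list whose point differences lie in `span{I_{u,v}}` — 38 g2's `Q_II` = the cube of
interaction differences over 6-tuples with ANY base point, seed S1 of wave 7 — is twin-blind and DECIDED (`interSpan_decided`):
`xc(COR(n) + Q_II) ≥ 1.5^{k−2} − 1`.  This sits OUTSIDE 40 g5 §5d `no_pure_block_of_private` (that no-go needs the generator supported inside
the row board `U × U`; here every `I_{u,v}` straddles `U = ι₁ univ` and the FIXED column part `S = ι₂ univ`) and outside 38 g2 §10 (the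
transversal face `F_π`; here the face is `{b ⊇ ι₂ univ}`).  ENEMY SPEC (E19): an enemy of C′ must move some twin row `udRow(ι₁a) − udRow(ι₂a)`
for EVERY twin pair `(ι₁, ι₂)` covering all but `O(1)` points — equivalently its direction space must NOT have equal symmetrised diagonal
twin blocks. -/

section Twin
variable {k n : ℕ}

theorem flat_neg₄₁ (M : Matrix (Fin n) (Fin n) ℝ) : flat (-M) = -flat M := by
  funext p; rfl

theorem flat_sub₄₁ (A B : Matrix (Fin n) (Fin n) ℝ) : flat (A - B) = flat A - flat B := by
  funext p; rfl

theorem flat_add₄₁ (A B : Matrix (Fin n) (Fin n) ℝ) : flat (A + B) = flat A + flat B := by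
  funext p; rfl

/-- the images of `ι₁` and `ι₂` are disjoint. -/
theorem map_inter_map_eq_empty (ι₁ ι₂ : Fin k ↪ Fin n) (hι : ∀ i j, ι₁ i ≠ ι₂ j) (s t : Finset (Fin k)) :
    s.map ι₁ ∩ t.map ι₂ = ∅ := by
  classical
  refine Finset.disjoint_iff_inter_eq_empty.mp (Finset.disjoint_left.mpr ?_)
  intro x hx hx'
  obtain ⟨i, -, rfl⟩ := Finset.mem_map.mp hx
  obtain ⟨j, -, hj⟩ := Finset.mem_map.mp hx'
  exact hι i j hj.symm

theorem map_inter_col (ι₁ ι₂ : Fin k ↪ Fin n) (hι : ∀ i j, ι₁ i ≠ ι₂ j) (s t : Finset (Fin k)) :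
    s.map ι₁ ∩ (t.map ι₁ ∪ (Finset.univ : Finset (Fin k)).map ι₂) = (s ∩ t).map ι₁ := by
  classical
  rw [Finset.inter_union_distrib_left, map_inter_map_eq_empty ι₁ ι₂ hι, Finset.union_empty]
  exact (Finset.map_inter _ _).symm

theorem map_inter_col' (ι₁ ι₂ : Fin k ↪ Fin n) (hι : ∀ i j, ι₁ i ≠ ι₂ j) (s t : Finset (Fin k)) :
    s.map ι₂ ∩ (t.map ι₁ ∪ (Finset.univ : Finset (Fin k)).map ι₂) = s.map ι₂ := by
  classical
  rw [Finset.inter_union_distrib_left]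
  have h1 : s.map ι₂ ∩ t.map ι₁ = ∅ := by rw [Finset.inter_comm]; exact map_inter_map_eq_empty ι₁ ι₂ hι t s
  have h2 : s.map ι₂ ∩ (Finset.univ : Finset (Fin k)).map ι₂ = s.map ι₂ :=
    Finset.inter_eq_left.mpr (Finset.map_subset_map.mpr (Finset.subset_univ s))
  rw [h1, h2, Finset.empty_union]

/-- the ANTIPODAL TWIN ROW of `a ⊆ Fin k`: `udRow (ι₁ a) − udRow (ι₂ a)`. -/
noncomputable def twinRow (ι₁ ι₂ : Fin k ↪ Fin n) (a : Finset (Fin k)) : Fin (n * n) → ℝ :=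
  udRow (a.map ι₁) - udRow (a.map ι₂)

theorem twinRow_dot_udPt (ι₁ ι₂ : Fin k ↪ Fin n) (a : Finset (Fin k)) (b : Finset (Fin n)) :
    twinRow ι₁ ι₂ a ⬝ᵥ udPt b = (1 - ((a.map ι₂ ∩ b).card : ℝ)) ^ 2 - (1 - ((a.map ι₁ ∩ b).card : ℝ)) ^ 2 := by
  classical
  obtain ⟨-, -, slack, -⟩ := ud_data n
  have h1 := slack (a.map ι₁) b
  have h2 := slack (a.map ι₂) b
  unfold twinRow
  rw [sub_dotProduct]
  linarith

theorem negUd_dot (ι₂ : Fin k ↪ Fin n) (a : Finset (Fin k)) (b : Finset (Fin n)) :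
    flat (-udMat (a.map ι₂)) ⬝ᵥ udPt b = (1 - ((a.map ι₂ ∩ b).card : ℝ)) ^ 2 - 1 := by
  classical
  obtain ⟨-, -, slack, -⟩ := ud_data n
  have h2 := slack (a.map ι₂) b
  rw [flat_neg₄₁, neg_dotProduct]
  change -(udRow (a.map ι₂) ⬝ᵥ udPt b) = _
  linarith

/-- `hCOR(−udMat (ι₂ a)) = (|a| − 1)² − 1` for `|a| ≥ 2` (attained at `b = ι₂ a`). -/
theorem hCOR_negUd (ι₂ : Fin k ↪ Fin n) (a : Finset (Fin k)) (ha : 2 ≤ a.card) :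
    hCOR (-udMat (a.map ι₂)) = ((a.card : ℝ) - 1) ^ 2 - 1 := by
  classical
  apply le_antisymm
  · obtain ⟨b, hb⟩ := exists_eq_hCOR (-udMat (a.map ι₂))
    rw [← hb, negUd_dot]
    have hle : ((a.map ι₂ ∩ b).card : ℝ) ≤ a.card := by
      have := Finset.card_le_card (Finset.inter_subset_left : a.map ι₂ ∩ b ⊆ a.map ι₂)
      rw [Finset.card_map] at this
      exact_mod_cast this
    have h0 : (0 : ℝ) ≤ (a.map ι₂ ∩ b).card := Nat.cast_nonneg _
    have h2 : (2 : ℝ) ≤ a.card := by exact_mod_cast ha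
    nlinarith [mul_nonneg (by linarith : (0 : ℝ) ≤ a.card + (a.map ι₂ ∩ b).card - 2)
      (by linarith : (0 : ℝ) ≤ a.card - (a.map ι₂ ∩ b).card)]
  · have h := le_hCOR (-udMat (a.map ι₂)) (a.map ι₂)
    rw [negUd_dot, Finset.inter_self, Finset.card_map] at h
    have e : ((a.card : ℝ) - 1) ^ 2 = (1 - (a.card : ℝ)) ^ 2 := by ring
    rw [e]
    exact h

/-- «TWIN-BLIND» passenger lists: every antipodal twin row is CONSTANT on the listed points. -/
def TwinBlind (ι₁ ι₂ : Fin k ↪ Fin n) {K : ℕ} (q : Fin (K + 1) → (Fin (n * n) → ℝ)) : Prop :=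
  ∀ (a : Finset (Fin k)) (j j' : Fin (K + 1)), twinRow ι₁ ι₂ a ⬝ᵥ q j = twinRow ι₁ ι₂ a ⬝ᵥ q j'

/-- ★★★ THE TWIN BLOCK (pure UDISJ of size `k − 2`).  For ANY twin-blind passenger list, two labels `z₁ ≠ z₂`, ANY admissible row maxima and
ANY nonnegative factorization of the exact-law located slack of `(COR(n), q)` through `Option (Fin r)`: `3^{k−2} ≤ (r+1)·2^{k−2}` — rows
`(ι₁(a' ∪ {z₁,z₂}), −udMat (ι₂(a' ∪ {z₁,z₂})))`, columns `(ι₁ b' ∪ ι₂ univ, 0)`. -/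
theorem twin_block (ι₁ ι₂ : Fin k ↪ Fin n) (hι : ∀ i j, ι₁ i ≠ ι₂ j) {K r : ℕ} (q : Fin (K + 1) → (Fin (n * n) → ℝ))
    (hq : TwinBlind ι₁ ι₂ q) {z₁ z₂ : Fin k} (hz : z₁ ≠ z₂)
    (mrow : exactTilted.A n → ℝ) (_hm1 : ∀ a j, exactTilted.ρ n a ⬝ᵥ q j ≤ mrow a)
    (hm2 : ∀ a, ∃ j, exactTilted.ρ n a ⬝ᵥ q j = mrow a)
    (U : exactTilted.A n → Option (Fin r) → ℝ) (V : Finset (Fin n) × Fin (K + 1) → Option (Fin r) → ℝ)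
    (hU : ∀ a i, 0 ≤ U a i) (hV : ∀ p i, 0 ≤ V p i)
    (hfac : ∀ a b j, (exactTilted.β n a + mrow a) - exactTilted.ρ n a ⬝ᵥ (udPt b + q j) = ∑ i, U a i * V (b, j) i) :
    3 ^ (k - 2) ≤ (r + 1) * 2 ^ (k - 2) := by
  classical
  set α : Finset (Fin k) := (Finset.univ.erase z₁).erase z₂ with hαdef
  have hz₂ : z₂ ∈ Finset.univ.erase z₁ := Finset.mem_erase.mpr ⟨hz.symm, Finset.mem_univ _⟩
  have hαcard : α.card = k - 2 := by
    rw [hαdef, Finset.card_erase_of_mem hz₂, Finset.card_erase_of_mem (Finset.mem_univ _), Finset.card_univ, Fintype.card_fin]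
    omega
  have hαmem : ∀ x ∈ α, x ≠ z₁ ∧ x ≠ z₂ := fun x hx => by
    simp only [hαdef, Finset.mem_erase] at hx
    exact ⟨hx.2.1, hx.1⟩
  have hz₁e : ∀ s : Finset ↥α, z₁ ∉ embα α s := fun s h => (hαmem _ (mem_of_mem_embα h)).1 rfl
  have hz₂e : ∀ s : Finset ↥α, z₂ ∉ embα α s := fun s h => (hαmem _ (mem_of_mem_embα h)).2 rfl
  -- full row index sets `a' ∪ {z₁, z₂}`
  let full : Finset ↥α → Finset (Fin k) := fun a' => insert z₁ (insert z₂ (embα α a'))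
  have hfull_card : ∀ a', (full a').card = a'.card + 2 := fun a' => by
    have h1 : z₁ ∉ insert z₂ (embα α a') := fun h => by
      rcases Finset.mem_insert.mp h with h | h
      · exact hz h
      · exact hz₁e a' h
    show (insert z₁ (insert z₂ (embα α a'))).card = _
    rw [Finset.card_insert_of_notMem h1, Finset.card_insert_of_notMem (hz₂e a'), card_embα]
  have hfull_inter : ∀ a' b' : Finset ↥α, full a' ∩ embα α b' = embα α (a' ∩ b') := fun a' b' => by
    show insert z₁ (insert z₂ (embα α a')) ∩ embα α b' = _
    rw [Finset.insert_inter_of_notMem (hz₁e b'), Finset.insert_inter_of_notMem (hz₂e b'), embα_inter]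
  -- rows and columns
  let row : Finset ↥α → exactTilted.A n := fun a' => ((full a').map ι₁, -udMat ((full a').map ι₂))
  let colset : Finset ↥α → Finset (Fin n) := fun b' => (embα α b').map ι₁ ∪ (Finset.univ : Finset (Fin k)).map ι₂
  have hρ : ∀ a', exactTilted.ρ n (row a') = twinRow ι₁ ι₂ (full a') := fun a' => by
    show udRow ((full a').map ι₁) + flat (-udMat ((full a').map ι₂)) = udRow ((full a').map ι₁) - flat (udMat ((full a').map ι₂))
    rw [flat_neg₄₁, sub_eq_add_neg]
  have hβ : ∀ a', exactTilted.β n (row a') = 1 + hCOR (-udMat ((full a').map ι₂)) := fun _ => rfl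
  -- twin-blindness: the passenger part of the located slack vanishes
  have hpass : ∀ a' j, exactTilted.ρ n (row a') ⬝ᵥ q j = mrow (row a') := fun a' j => by
    obtain ⟨j', hj'⟩ := hm2 (row a')
    rw [← hj', hρ]
    exact hq (full a') j j'
  -- the block identity
  have key := three_pow_le_of_block U V hU hV row (fun b' => (colset b', (0 : Fin (K + 1)))) (fun a' b' => ?_)
  · have h1 : Fintype.card ↥α = k - 2 := by rw [Fintype.card_coe, hαcard]
    have h2 : Fintype.card (Option (Fin r)) = r + 1 := by simp
    rw [h1, h2] at key
    exact key
  · have hi1 : (full a').map ι₁ ∩ colset b' = (embα α (a' ∩ b')).map ι₁ := by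
      show (full a').map ι₁ ∩ ((embα α b').map ι₁ ∪ (Finset.univ : Finset (Fin k)).map ι₂) = _
      rw [map_inter_col ι₁ ι₂ hι, hfull_inter]
    have hi2 : (full a').map ι₂ ∩ colset b' = (full a').map ι₂ := map_inter_col' ι₁ ι₂ hι _ _
    rw [← hfac (row a') (colset b') 0, dotProduct_add, hpass a' 0, hβ, hCOR_negUd ι₂ _ (by rw [hfull_card]; omega), hρ,
      twinRow_dot_udPt, hi1, hi2, Finset.card_map, Finset.card_map, card_embα, hfull_card]
    push_cast
    ring

/-- rate: a block of size `g` with `n ≤ 2g + 5` beats `T c n` eventually. -/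
theorem T_lt_of_block_wide (c : ℕ) : ∃ n₀ : ℕ, ∀ n ≥ n₀, ∀ g r : ℕ, n ≤ 2 * g + 5 → 3 ^ g ≤ (r + 1) * 2 ^ g → T c n < r := by
  obtain ⟨t₁, ht₁⟩ := four_T_lt_two_pow c (c₀ := 1 / 6) (by norm_num)
  refine ⟨max t₁ 40, fun n hn g r hng hr => ?_⟩
  have hn40 : 40 ≤ n := le_of_max_le_right hn
  have hdiv : n ≤ 6 * (g / 2) := by omega
  have hreal : (1 / 6 : ℝ) * n ≤ ((g / 2 : ℕ) : ℝ) := by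
    have : (n : ℝ) ≤ 6 * ((g / 2 : ℕ) : ℝ) := by exact_mod_cast hdiv
    linarith
  have h4 := ht₁ n (le_of_max_le_left hn) (g / 2) hreal
  have hpow : 2 ^ (g / 2) * 2 ^ g ≤ (r + 1) * 2 ^ g := (two_pow_half_mul_le g).trans hr
  have hle : 2 ^ (g / 2) ≤ r + 1 := Nat.le_of_mul_le_mul_right hpow (Nat.pos_of_ne_zero (by positivity))
  have hT : 1 ≤ T c n := Nat.one_le_two_pow
  unfold T at hT ⊢
  omega

/-- ★★★★ **TWIN-BLIND PASSENGERS ARE DECIDED** (flat socket, eventually in `n`, BY NAME via the tree's `concl_of_lawBody exactTilted`): for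
`n ≥ n₀(c)`, any twins `ι₁ ι₂ : Fin k ↪ Fin n` with disjoint images and `n ≤ 2k + 1`, every twin-blind passenger list `q` satisfies
`HasEFOfSize (COR(n) + conv q) r → T c n < r`. -/
theorem twinBlind_decided (c₀ : ℕ) : ∃ n₀ : ℕ, ∀ n ≥ n₀, ∀ (k : ℕ) (ι₁ ι₂ : Fin k ↪ Fin n), (∀ i j, ι₁ i ≠ ι₂ j) → n ≤ 2 * k + 1 →
    ∀ (K : ℕ) (q : Fin (K + 1) → (Fin (n * n) → ℝ)) (r : ℕ), TwinBlind ι₁ ι₂ q →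
    HasEFOfSize (corPolytope n + convexHull ℝ (Set.range q)) r → T c₀ n < r := by
  classical
  obtain ⟨n₀, hn₀⟩ := T_lt_of_block_wide c₀
  refine ⟨max n₀ 5, fun n hn k ι₁ ι₂ hι hnk K q r hq hR => ?_⟩
  have hn5 : 5 ≤ n := le_of_max_le_right hn
  have hk2 : 2 ≤ k := by omega
  refine concl_of_lawBody exactTilted q (fun m hm1 hm2 U V hU hV hfac => ?_) hR
  have hz : (⟨0, by omega⟩ : Fin k) ≠ ⟨1, by omega⟩ := Fin.ne_of_val_ne (by norm_num)
  have hblock := twin_block ι₁ ι₂ hι q hq hz m hm1 hm2 U V hU hV hfac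
  exact hn₀ n (le_of_max_le_left hn) (k - 2) r (by omega) hblock

/-! ### §5b  38 g2's interaction matrices are invisible to twin rows ⇒ `Q_II` is twin-blind ⇒ DECIDED -/

/-- the symmetric elementary matrix `Eˢ_{xy} = E_{xy} + E_{yx}`. -/
def Es (x y : Fin n) : Matrix (Fin n) (Fin n) ℝ := fun i j =>
  (if i = x ∧ j = y then 1 else 0) + (if i = y ∧ j = x then 1 else 0)

/-- 38 g2's INTERACTION MATRIX `I_{u,v} := Eˢ_{ι₁u ι₁v} − Eˢ_{ι₁u ι₂v} − Eˢ_{ι₂u ι₁v} + Eˢ_{ι₂u ι₂v}` (`ExactPencil38` §10; `Q_II` is the cube of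
differences `I_{u,v} − I_{u,v'}` over 6-tuples with a base point). -/
def interMat (ι₁ ι₂ : Fin k ↪ Fin n) (u v : Fin k) : Matrix (Fin n) (Fin n) ℝ :=
  Es (ι₁ u) (ι₁ v) - Es (ι₁ u) (ι₂ v) - Es (ι₂ u) (ι₁ v) + Es (ι₂ u) (ι₂ v)

theorem flat_dot_Es (M : Matrix (Fin n) (Fin n) ℝ) (x y : Fin n) : flat M ⬝ᵥ flat (Es x y) = M x y + M y x := by
  have h : ∀ x y : Fin n, ∑ i, ∑ j, M i j * (if i = x ∧ j = y then (1 : ℝ) else 0) = M x y := by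
    intro x y
    rw [Fintype.sum_eq_single x (fun i hi => Finset.sum_eq_zero (fun j _ => by rw [if_neg (fun h => hi h.1), mul_zero])),
      Fintype.sum_eq_single y (fun j hj => by rw [if_neg (fun h => hj h.2), mul_zero])]
    simp
  rw [flat_dotProduct_flat]
  simp only [Es, mul_add, Finset.sum_add_distrib]
  rw [h, h]

theorem udInd_map_self (ι : Fin k ↪ Fin n) (a : Finset (Fin k)) (u : Fin k) : udInd (a.map ι) (ι u) = udInd a u := by
  simp only [udInd_apply, Finset.mem_map']

theorem udInd_map_other (ι ι' : Fin k ↪ Fin n) (h : ∀ i j, ι i ≠ ι' j) (a : Finset (Fin k)) (u : Fin k) :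
    udInd (a.map ι) (ι' u) = 0 := by
  rw [udInd_apply, if_neg]
  intro hu
  obtain ⟨i, -, hi⟩ := Finset.mem_map.mp hu
  exact h i u hi

theorem flat_dot_interMat (M : Matrix (Fin n) (Fin n) ℝ) (ι₁ ι₂ : Fin k ↪ Fin n) (u v : Fin k) :
    flat M ⬝ᵥ flat (interMat ι₁ ι₂ u v)
      = (M (ι₁ u) (ι₁ v) + M (ι₁ v) (ι₁ u)) - (M (ι₁ u) (ι₂ v) + M (ι₂ v) (ι₁ u))
        - (M (ι₂ u) (ι₁ v) + M (ι₁ v) (ι₂ u)) + (M (ι₂ u) (ι₂ v) + M (ι₂ v) (ι₂ u)) := by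
  unfold interMat
  rw [flat_add₄₁, flat_sub₄₁, flat_sub₄₁, dotProduct_add, dotProduct_sub, dotProduct_sub, flat_dot_Es, flat_dot_Es, flat_dot_Es,
    flat_dot_Es]

/-- ★ every twin row is ORTHOGONAL to every interaction matrix. -/
theorem twinRow_dot_interMat (ι₁ ι₂ : Fin k ↪ Fin n) (hι : ∀ i j, ι₁ i ≠ ι₂ j) (a : Finset (Fin k)) (u v : Fin k) :
    twinRow ι₁ ι₂ a ⬝ᵥ flat (interMat ι₁ ι₂ u v) = 0 := by
  have hι' : ∀ i j, ι₂ i ≠ ι₁ j := fun i j h => hι j i h.symm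
  have htw : twinRow ι₁ ι₂ a = flat (udMat (a.map ι₁) - udMat (a.map ι₂)) := by
    unfold twinRow udRow; rw [flat_sub₄₁]
  rw [htw, flat_dot_interMat]
  simp only [Matrix.sub_apply, udMat, udInd_map_self, udInd_map_other ι₁ ι₂ hι, udInd_map_other ι₂ ι₁ hι',
    EmbeddingLike.apply_eq_iff_eq, hι, hι', if_false]
  ring

/-- every passenger list whose point differences lie in `span{I_{u,v}}` is twin-blind (in particular `Q_II` with any base point). -/
theorem twinBlind_of_interSpan (ι₁ ι₂ : Fin k ↪ Fin n) (hι : ∀ i j, ι₁ i ≠ ι₂ j) {K : ℕ} (q : Fin (K + 1) → (Fin (n * n) → ℝ))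
    (hq : ∀ j j', q j - q j' ∈ Submodule.span ℝ (Set.range fun p : Fin k × Fin k => flat (interMat ι₁ ι₂ p.1 p.2))) :
    TwinBlind ι₁ ι₂ q := by
  intro a j j'
  have hker : ∀ x, x ∈ Submodule.span ℝ (Set.range fun p : Fin k × Fin k => flat (interMat ι₁ ι₂ p.1 p.2)) →
      twinRow ι₁ ι₂ a ⬝ᵥ x = 0 := by
    intro x hx
    induction hx using Submodule.span_induction with
    | mem v hv =>
      obtain ⟨p, rfl⟩ := hv
      exact twinRow_dot_interMat ι₁ ι₂ hι a p.1 p.2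
    | zero => simp
    | add x y _ _ hx hy => rw [dotProduct_add, hx, hy, add_zero]
    | smul c x _ hx => rw [dotProduct_smul, hx, smul_zero]
  have h0 := hker _ (hq j j')
  rw [dotProduct_sub] at h0
  linarith

/-- ★★★★ **`Q_II` IS DECIDED**: for `n ≥ n₀(c)` and twins covering all but `≤ 1` point, EVERY passenger list whose point differences lie in
`span{I_{u,v}}` (38 g2's `Q_II`, any base point, any budget) satisfies `HasEFOfSize (COR(n) + conv q) r → T c n < r`. -/
theorem interSpan_decided (c₀ : ℕ) : ∃ n₀ : ℕ, ∀ n ≥ n₀, ∀ (k : ℕ) (ι₁ ι₂ : Fin k ↪ Fin n), (∀ i j, ι₁ i ≠ ι₂ j) → n ≤ 2 * k + 1 →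
    ∀ (K : ℕ) (q : Fin (K + 1) → (Fin (n * n) → ℝ)) (r : ℕ),
    (∀ j j', q j - q j' ∈ Submodule.span ℝ (Set.range fun p : Fin k × Fin k => flat (interMat ι₁ ι₂ p.1 p.2))) →
    HasEFOfSize (corPolytope n + convexHull ℝ (Set.range q)) r → T c₀ n < r := by
  obtain ⟨n₀, hn₀⟩ := twinBlind_decided c₀
  exact ⟨n₀, fun n hn k ι₁ ι₂ hι hnk K q r hq hR => hn₀ n hn k ι₁ ι₂ hι hnk K q r (twinBlind_of_interSpan ι₁ ι₂ hι q hq) hR⟩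

/-! ### §5c (E20) THE EXPLICIT EDGE TEST and the junk-tolerant twin block

`twinRow a ⬝ᵥ flat M = Σ_{i,m} udMat a i m · (M (ι₁ i) (ι₁ m) − M (ι₂ i) (ι₂ m))` (`twinRow_dot_flat`): a twin row reads ONLY the difference of the
two diagonal twin blocks, through the symmetric matrix `udMat a`.  Hence (the test object crit-9 V#88 asks for — the passenger's EDGE / difference
directions): if every difference `Qm j − Qm j'` has EQUAL SYMMETRISED DIAGONAL TWIN BLOCKS, the passenger is twin-blind (`twinBlind_of_blocks`) and
DECIDED (`blocks_decided`).  Junk-tolerantly (KW needs zeros only on the `|a∩b| = 1` cells): a PARTIAL common maximiser of the twin rows per column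
(`TwinPCM`) already gives the block (`twin_pattern_block`, `twinPCM_decided`). -/

/-- symmetric × antisymmetric sums vanish. -/
theorem sum_symm_mul_antisymm (S X : Fin k → Fin k → ℝ) (hS : ∀ i m, S i m = S m i) (hX : ∀ i m, X i m + X m i = 0) :
    ∑ i, ∑ m, S i m * X i m = 0 := by
  have h1 : ∑ i, ∑ m, S i m * X i m = ∑ i, ∑ m, S m i * X m i := Finset.sum_comm
  have h2 : ∑ i, ∑ m, S m i * X m i = ∑ i, ∑ m, -(S i m * X i m) := by
    refine Finset.sum_congr rfl fun i _ => Finset.sum_congr rfl fun m _ => ?_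
    rw [hS m i, show X m i = -X i m by linarith [hX i m]]
    ring
  rw [h2] at h1
  simp only [Finset.sum_neg_distrib] at h1
  linarith

theorem udMat_map_apply (ι : Fin k ↪ Fin n) (a : Finset (Fin k)) (i m : Fin k) :
    udMat (a.map ι) (ι i) (ι m) = udMat a i m := by
  simp only [udMat, udInd_map_self, EmbeddingLike.apply_eq_iff_eq]

theorem udMat_map_eq_zero_left (ι : Fin k ↪ Fin n) (a : Finset (Fin k)) {x : Fin n}
    (hx : x ∉ (Finset.univ : Finset (Fin k)).map ι) (y : Fin n) : udMat (a.map ι) x y = 0 := by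
  have h0 : udInd (a.map ι) x = 0 := by
    rw [udInd_apply, if_neg]
    exact fun h => hx (Finset.map_subset_map.mpr (Finset.subset_univ a) h)
  simp only [udMat, h0, mul_zero, zero_mul, sub_zero]

theorem udMat_map_eq_zero_right (ι : Fin k ↪ Fin n) (a : Finset (Fin k)) (x : Fin n) {y : Fin n}
    (hy : y ∉ (Finset.univ : Finset (Fin k)).map ι) : udMat (a.map ι) x y = 0 := by
  have h0 : udInd (a.map ι) y = 0 := by
    rw [udInd_apply, if_neg]
    exact fun h => hy (Finset.map_subset_map.mpr (Finset.subset_univ a) h)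
  by_cases hxy : x = y
  · subst hxy
    simp only [udMat, h0, mul_zero, sub_zero]
  · simp only [udMat, hxy, if_false, mul_zero, zero_mul, h0, sub_zero]

/-- reindex a sum over `Fin n` supported on the image of `ι`. -/
theorem sum_eq_sum_map (ι : Fin k ↪ Fin n) (g : Fin n → ℝ) (hg : ∀ x, x ∉ (Finset.univ : Finset (Fin k)).map ι → g x = 0) :
    ∑ x, g x = ∑ i, g (ι i) := by
  rw [← Finset.sum_subset (Finset.subset_univ ((Finset.univ : Finset (Fin k)).map ι)) (fun x _ hx => hg x hx), Finset.sum_map]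

theorem udRow_map_dot_flat (ι : Fin k ↪ Fin n) (a : Finset (Fin k)) (M : Matrix (Fin n) (Fin n) ℝ) :
    udRow (a.map ι) ⬝ᵥ flat M = ∑ i, ∑ m, udMat a i m * M (ι i) (ι m) := by
  unfold udRow
  rw [flat_dotProduct_flat]
  rw [sum_eq_sum_map ι _ (fun x hx => Finset.sum_eq_zero fun y _ => by rw [udMat_map_eq_zero_left ι a hx, zero_mul])]
  refine Finset.sum_congr rfl fun i _ => ?_
  rw [sum_eq_sum_map ι _ (fun y hy => by rw [udMat_map_eq_zero_right ι a _ hy, zero_mul])]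
  refine Finset.sum_congr rfl fun m _ => ?_
  rw [udMat_map_apply]

/-- ★ THE EDGE TEST OBJECT: a twin row reads only the DIFFERENCE OF THE TWO DIAGONAL TWIN BLOCKS (through the symmetric `udMat a`). -/
theorem twinRow_dot_flat (ι₁ ι₂ : Fin k ↪ Fin n) (a : Finset (Fin k)) (M : Matrix (Fin n) (Fin n) ℝ) :
    twinRow ι₁ ι₂ a ⬝ᵥ flat M = ∑ i, ∑ m, udMat a i m * (M (ι₁ i) (ι₁ m) - M (ι₂ i) (ι₂ m)) := by
  unfold twinRow
  rw [sub_dotProduct, udRow_map_dot_flat, udRow_map_dot_flat, ← Finset.sum_sub_distrib]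
  refine Finset.sum_congr rfl fun i _ => ?_
  rw [← Finset.sum_sub_distrib]
  refine Finset.sum_congr rfl fun m _ => ?_
  ring

theorem udMat_symm (a : Finset (Fin k)) (i m : Fin k) : udMat a i m = udMat a m i := by
  by_cases h : i = m
  · subst h; rfl
  · have h' : ¬ m = i := fun e => h e.symm
    simp only [udMat, h, h', if_false]
    ring

/-- ★★ EQUAL SYMMETRISED DIAGONAL TWIN BLOCKS OF EVERY DIFFERENCE ⇒ TWIN-BLIND (the explicit, mechanically checkable edge test (E19)/(E20)). -/
theorem twinBlind_of_blocks (ι₁ ι₂ : Fin k ↪ Fin n) {K : ℕ} (Qm : Fin (K + 1) → Matrix (Fin n) (Fin n) ℝ)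
    (hblk : ∀ (j j' : Fin (K + 1)) (i m : Fin k),
      ((Qm j - Qm j') (ι₁ i) (ι₁ m) + (Qm j - Qm j') (ι₁ m) (ι₁ i))
        = ((Qm j - Qm j') (ι₂ i) (ι₂ m) + (Qm j - Qm j') (ι₂ m) (ι₂ i))) :
    TwinBlind ι₁ ι₂ (fun j => flat (Qm j)) := by
  intro a j j'
  have h0 : twinRow ι₁ ι₂ a ⬝ᵥ flat (Qm j - Qm j') = 0 := by
    rw [twinRow_dot_flat]
    exact sum_symm_mul_antisymm (fun i m => udMat a i m) _ (udMat_symm a) (fun i m => by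
      have := hblk j j' i m
      linarith)
  rw [flat_sub₄₁, dotProduct_sub] at h0
  show twinRow ι₁ ι₂ a ⬝ᵥ flat (Qm j) = twinRow ι₁ ι₂ a ⬝ᵥ flat (Qm j')
  linarith

/-- ★★★★ **EQUAL-TWIN-BLOCK PASSENGERS ARE DECIDED** (flat socket): matrices `Qm j` whose pairwise differences have equal symmetrised diagonal twin
blocks for SOME twin pair covering all but `≤ 1` point. -/
theorem blocks_decided (c₀ : ℕ) : ∃ n₀ : ℕ, ∀ n ≥ n₀, ∀ (k : ℕ) (ι₁ ι₂ : Fin k ↪ Fin n), (∀ i j, ι₁ i ≠ ι₂ j) → n ≤ 2 * k + 1 →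
    ∀ (K : ℕ) (Qm : Fin (K + 1) → Matrix (Fin n) (Fin n) ℝ) (r : ℕ),
    (∀ (j j' : Fin (K + 1)) (i m : Fin k), ((Qm j - Qm j') (ι₁ i) (ι₁ m) + (Qm j - Qm j') (ι₁ m) (ι₁ i))
        = ((Qm j - Qm j') (ι₂ i) (ι₂ m) + (Qm j - Qm j') (ι₂ m) (ι₂ i))) →
    HasEFOfSize (corPolytope n + convexHull ℝ (Set.range fun j => flat (Qm j))) r → T c₀ n < r := by
  obtain ⟨n₀, hn₀⟩ := twinBlind_decided c₀
  exact ⟨n₀, fun n hn k ι₁ ι₂ hι hnk K Qm r hblk hR => hn₀ n hn k ι₁ ι₂ hι hnk K _ r (twinBlind_of_blocks ι₁ ι₂ Qm hblk) hR⟩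

/-- «TWIN-PCM»: per column `b`, ONE listed point maximises every twin row `a` with `|a ∩ b| = 1` (junk elsewhere is ignored). -/
def TwinPCM (ι₁ ι₂ : Fin k ↪ Fin n) {K : ℕ} (q : Fin (K + 1) → (Fin (n * n) → ℝ)) : Prop :=
  ∀ b : Finset (Fin k), ∃ j : Fin (K + 1), ∀ a : Finset (Fin k), (a ∩ b).card = 1 →
    ∀ j', twinRow ι₁ ι₂ a ⬝ᵥ q j' ≤ twinRow ι₁ ι₂ a ⬝ᵥ q j

theorem twinPCM_of_twinBlind (ι₁ ι₂ : Fin k ↪ Fin n) {K : ℕ} {q : Fin (K + 1) → (Fin (n * n) → ℝ)} (hq : TwinBlind ι₁ ι₂ q) :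
    TwinPCM ι₁ ι₂ q :=
  fun _ => ⟨0, fun a _ j' => le_of_eq (hq a j' 0)⟩

/-- ★★★ THE JUNK-TOLERANT TWIN BLOCK: a partial common maximiser per column suffices for `3^{k−2} ≤ (r+1)·2^{k−2}`. -/
theorem twin_pattern_block (ι₁ ι₂ : Fin k ↪ Fin n) (hι : ∀ i j, ι₁ i ≠ ι₂ j) {K r : ℕ} (q : Fin (K + 1) → (Fin (n * n) → ℝ))
    (hq : TwinPCM ι₁ ι₂ q) {z₁ z₂ : Fin k} (hz : z₁ ≠ z₂)
    (mrow : exactTilted.A n → ℝ) (hm1 : ∀ a j, exactTilted.ρ n a ⬝ᵥ q j ≤ mrow a)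
    (hm2 : ∀ a, ∃ j, exactTilted.ρ n a ⬝ᵥ q j = mrow a)
    (U : exactTilted.A n → Option (Fin r) → ℝ) (V : Finset (Fin n) × Fin (K + 1) → Option (Fin r) → ℝ)
    (hU : ∀ a i, 0 ≤ U a i) (hV : ∀ p i, 0 ≤ V p i)
    (hfac : ∀ a b j, (exactTilted.β n a + mrow a) - exactTilted.ρ n a ⬝ᵥ (udPt b + q j) = ∑ i, U a i * V (b, j) i) :
    3 ^ (k - 2) ≤ (r + 1) * 2 ^ (k - 2) := by
  classical
  set α : Finset (Fin k) := (Finset.univ.erase z₁).erase z₂ with hαdef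
  have hz₂ : z₂ ∈ Finset.univ.erase z₁ := Finset.mem_erase.mpr ⟨hz.symm, Finset.mem_univ _⟩
  have hαcard : α.card = k - 2 := by
    rw [hαdef, Finset.card_erase_of_mem hz₂, Finset.card_erase_of_mem (Finset.mem_univ _), Finset.card_univ, Fintype.card_fin]
    omega
  have hαmem : ∀ x ∈ α, x ≠ z₁ ∧ x ≠ z₂ := fun x hx => by
    simp only [hαdef, Finset.mem_erase] at hx
    exact ⟨hx.2.1, hx.1⟩
  have hz₁e : ∀ s : Finset ↥α, z₁ ∉ embα α s := fun s h => (hαmem _ (mem_of_mem_embα h)).1 rfl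
  have hz₂e : ∀ s : Finset ↥α, z₂ ∉ embα α s := fun s h => (hαmem _ (mem_of_mem_embα h)).2 rfl
  let full : Finset ↥α → Finset (Fin k) := fun a' => insert z₁ (insert z₂ (embα α a'))
  have hfull_card : ∀ a', (full a').card = a'.card + 2 := fun a' => by
    have h1 : z₁ ∉ insert z₂ (embα α a') := fun h => by
      rcases Finset.mem_insert.mp h with h | h
      · exact hz h
      · exact hz₁e a' h
    show (insert z₁ (insert z₂ (embα α a'))).card = _
    rw [Finset.card_insert_of_notMem h1, Finset.card_insert_of_notMem (hz₂e a'), card_embα]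
  have hfull_inter : ∀ a' b' : Finset ↥α, full a' ∩ embα α b' = embα α (a' ∩ b') := fun a' b' => by
    show insert z₁ (insert z₂ (embα α a')) ∩ embα α b' = _
    rw [Finset.insert_inter_of_notMem (hz₁e b'), Finset.insert_inter_of_notMem (hz₂e b'), embα_inter]
  let row : Finset ↥α → exactTilted.A n := fun a' => ((full a').map ι₁, -udMat ((full a').map ι₂))
  let colset : Finset ↥α → Finset (Fin n) := fun b' => (embα α b').map ι₁ ∪ (Finset.univ : Finset (Fin k)).map ι₂
  have hρ : ∀ a', exactTilted.ρ n (row a') = twinRow ι₁ ι₂ (full a') := fun a' => by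
    show udRow ((full a').map ι₁) + flat (-udMat ((full a').map ι₂)) = udRow ((full a').map ι₁) - flat (udMat ((full a').map ι₂))
    rw [flat_neg₄₁, sub_eq_add_neg]
  have hβ : ∀ a', exactTilted.β n (row a') = 1 + hCOR (-udMat ((full a').map ι₂)) := fun _ => rfl
  -- the partial common maximisers
  unfold TwinPCM at hq
  choose jc hjc using hq
  -- the COR part of the located slack on the block
  have hcor : ∀ a' b' : Finset ↥α, exactTilted.β n (row a') - exactTilted.ρ n (row a') ⬝ᵥ udPt (colset b')
      = (1 - ((a' ∩ b').card : ℝ)) ^ 2 := fun a' b' => by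
    have hi1 : (full a').map ι₁ ∩ colset b' = (embα α (a' ∩ b')).map ι₁ := by
      show (full a').map ι₁ ∩ ((embα α b').map ι₁ ∪ (Finset.univ : Finset (Fin k)).map ι₂) = _
      rw [map_inter_col ι₁ ι₂ hι, hfull_inter]
    have hi2 : (full a').map ι₂ ∩ colset b' = (full a').map ι₂ := map_inter_col' ι₁ ι₂ hι _ _
    rw [hβ, hCOR_negUd ι₂ _ (by rw [hfull_card]; omega), hρ, twinRow_dot_udPt, hi1, hi2, Finset.card_map, Finset.card_map, card_embα,
      hfull_card]
    push_cast
    ring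
  have key := three_pow_le_of_pattern U V hU hV row (fun b' => (colset b', jc (embα α b'))) (fun a' b' hab => ?_) (fun a' b' hab => ?_)
  · have h1 : Fintype.card ↥α = k - 2 := by rw [Fintype.card_coe, hαcard]
    have h2 : Fintype.card (Option (Fin r)) = r + 1 := by simp
    rw [h1, h2] at key
    exact key
  · -- zero cells: `|a' ∩ b'| = 1` ⇒ COR part 0 and the column's index maximises the row
    have hfull1 : (full a' ∩ embα α b').card = 1 := by rw [hfull_inter, card_embα, hab]
    have hmax : exactTilted.ρ n (row a') ⬝ᵥ q (jc (embα α b')) = mrow (row a') := by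
      apply le_antisymm (hm1 _ _)
      obtain ⟨j', hj'⟩ := hm2 (row a')
      rw [← hj', hρ]
      exact hjc (embα α b') (full a') hfull1 j'
    rw [← hfac (row a') (colset b') (jc (embα α b')), dotProduct_add, hmax]
    have := hcor a' b'
    rw [hab] at this
    push_cast at this
    linarith
  · -- positive cells: disjoint ⇒ COR part 1, passenger part ≥ 0
    have hab0 : (a' ∩ b').card = 0 := by rw [Finset.disjoint_iff_inter_eq_empty.mp hab, Finset.card_empty]
    rw [← hfac (row a') (colset b') (jc (embα α b')), dotProduct_add]
    have := hcor a' b'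
    rw [hab0] at this
    push_cast at this
    have hle := hm1 (row a') (jc (embα α b'))
    linarith

/-- ★★★★ **TWIN-PCM PASSENGERS ARE DECIDED** (flat socket; junk-tolerant version of `twinBlind_decided`). -/
theorem twinPCM_decided (c₀ : ℕ) : ∃ n₀ : ℕ, ∀ n ≥ n₀, ∀ (k : ℕ) (ι₁ ι₂ : Fin k ↪ Fin n), (∀ i j, ι₁ i ≠ ι₂ j) → n ≤ 2 * k + 1 →
    ∀ (K : ℕ) (q : Fin (K + 1) → (Fin (n * n) → ℝ)) (r : ℕ), TwinPCM ι₁ ι₂ q →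
    HasEFOfSize (corPolytope n + convexHull ℝ (Set.range q)) r → T c₀ n < r := by
  classical
  obtain ⟨n₀, hn₀⟩ := T_lt_of_block_wide c₀
  refine ⟨max n₀ 5, fun n hn k ι₁ ι₂ hι hnk K q r hq hR => ?_⟩
  have hn5 : 5 ≤ n := le_of_max_le_right hn
  have hk2 : 2 ≤ k := by omega
  refine concl_of_lawBody exactTilted q (fun m hm1 hm2 U V hU hV hfac => ?_) hR
  have hz : (⟨0, by omega⟩ : Fin k) ≠ ⟨1, by omega⟩ := Fin.ne_of_val_ne (by norm_num)
  have hblock := twin_pattern_block ι₁ ι₂ hι q hq hz m hm1 hm2 U V hU hV hfac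
  exact hn₀ n (le_of_max_le_left hn) (k - 2) r (by omega) hblock

/-! ### §5d (E21) ★★★★★ THE TWIN TRANSFER / S-TOP PINNING: a UNIQUE top of ONE nonneg `S × S`-functional decides the passenger

Add to the twin tilt a PIN `λ·P` with `P ≥ 0` entrywise, supported in `S × S` (`S = ι₂ univ`, the FIXED column part): `⟨P, x_b⟩ ≤ ⟨P, x_S⟩` for
every clique vertex with equality on every column `c ⊇ S`, so `hCOR(−udMat(ι₂ a) + λP) = (|a|−1)² − 1 + λ⟨P, x_S⟩` (`hCOR_pinTilt`) and the
COR-slack on the face `{ι₁ b ∪ S}` is STILL the pure `(1 − |a∩b|)²` — for every `λ ≥ 0`.  If `j ↦ ⟨flat P, q_j⟩` has a UNIQUE maximiser `j⋆`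
over the passenger's vertex list, then for `λ` large (`λ ≥ max ratio`, finite) `j⋆` is a COMMON maximiser of every pinned twin row, the
passenger part vanishes at `(·, j⋆)`, and the block is pure: ★★★ `pin_twin_block`, ★★★★★ `sTop_decided` (flat socket).  CONSEQUENCE: every
passenger whose listed points have pairwise DISTINCT `S × S` blocks for some near-half `S` is decided (a generic positive `P` separates them —
genericity on paper; the kernel theorem takes `P` and `j⋆` as data).  ENEMY SPEC (E21, hereditary): for EVERY near-half split `U ⊔ S` and EVERY
nonneg `P` on `S × S`, the `P`-top value over the vertex list is attained at least TWICE — and (iterating the argument inside the top fibre,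
whose `S × S` block is frozen) the `U × U`-shadows of that top fibre must themselves defeat the located law on `U`: an enemy of C′ is
HEREDITARILY TIED. -/

theorem flat_smul₄₁ (c : ℝ) (M : Matrix (Fin n) (Fin n) ℝ) : flat (c • M) = c • flat M := by
  funext p; rfl

/-- an entrywise-nonnegative matrix supported in `S × S` reads at most its total on any clique vertex … -/
theorem flat_nonneg_dot_le (P : Matrix (Fin n) (Fin n) ℝ) (S : Finset (Fin n)) (hP0 : ∀ x y, 0 ≤ P x y)
    (hPS : ∀ x y, P x y ≠ 0 → x ∈ S ∧ y ∈ S) (b : Finset (Fin n)) : flat P ⬝ᵥ udPt b ≤ flat P ⬝ᵥ udPt S := by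
  rw [show udPt b = vecOuter n (udInd b) from rfl, show udPt S = vecOuter n (udInd S) from rfl, flat_dotProduct_vecOuter,
    flat_dotProduct_vecOuter]
  refine Finset.sum_le_sum fun x _ => Finset.sum_le_sum fun y _ => ?_
  by_cases hP : P x y = 0
  · rw [hP, zero_mul, zero_mul]
  · obtain ⟨hx, hy⟩ := hPS x y hP
    have e1 : udInd S x = 1 := by rw [udInd_apply, if_pos hx]
    have e2 : udInd S y = 1 := by rw [udInd_apply, if_pos hy]
    rw [e1, e2, mul_one, mul_one]
    have hb1 : udInd b x * udInd b y ≤ 1 := by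
      rw [udInd_apply, udInd_apply]; split_ifs <;> norm_num
    nlinarith [hP0 x y]

/-- … and exactly its total on every column containing `S`. -/
theorem flat_supported_dot_eq (P : Matrix (Fin n) (Fin n) ℝ) (S : Finset (Fin n)) (hPS : ∀ x y, P x y ≠ 0 → x ∈ S ∧ y ∈ S)
    (c : Finset (Fin n)) (hc : S ⊆ c) : flat P ⬝ᵥ udPt c = flat P ⬝ᵥ udPt S := by
  rw [show udPt c = vecOuter n (udInd c) from rfl, show udPt S = vecOuter n (udInd S) from rfl, flat_dotProduct_vecOuter,
    flat_dotProduct_vecOuter]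
  refine Finset.sum_congr rfl fun x _ => Finset.sum_congr rfl fun y _ => ?_
  by_cases hP : P x y = 0
  · rw [hP, zero_mul, zero_mul]
  · obtain ⟨hx, hy⟩ := hPS x y hP
    simp only [udInd_apply, if_pos hx, if_pos hy, if_pos (hc hx), if_pos (hc hy)]

theorem negUd_sq_le (ι₂ : Fin k ↪ Fin n) (a : Finset (Fin k)) (ha : 2 ≤ a.card) (b : Finset (Fin n)) :
    (1 - ((a.map ι₂ ∩ b).card : ℝ)) ^ 2 - 1 ≤ ((a.card : ℝ) - 1) ^ 2 - 1 := by
  classical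
  have hle : ((a.map ι₂ ∩ b).card : ℝ) ≤ a.card := by
    have := Finset.card_le_card (Finset.inter_subset_left : a.map ι₂ ∩ b ⊆ a.map ι₂)
    rw [Finset.card_map] at this
    exact_mod_cast this
  have h0 : (0 : ℝ) ≤ (a.map ι₂ ∩ b).card := Nat.cast_nonneg _
  have h2 : (2 : ℝ) ≤ a.card := by exact_mod_cast ha
  nlinarith [mul_nonneg (by linarith : (0 : ℝ) ≤ a.card + (a.map ι₂ ∩ b).card - 2)
    (by linarith : (0 : ℝ) ≤ a.card - (a.map ι₂ ∩ b).card)]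

/-- ★ the PINNED twin tilt keeps an explicit `hCOR`: `hCOR(−udMat(ι₂ a) + λP) = (|a|−1)² − 1 + λ⟨P, x_S⟩`. -/
theorem hCOR_pinTilt (ι₂ : Fin k ↪ Fin n) (a : Finset (Fin k)) (ha : 2 ≤ a.card) (P : Matrix (Fin n) (Fin n) ℝ)
    (hP0 : ∀ x y, 0 ≤ P x y)
    (hPS : ∀ x y, P x y ≠ 0 → x ∈ (Finset.univ : Finset (Fin k)).map ι₂ ∧ y ∈ (Finset.univ : Finset (Fin k)).map ι₂)
    {lam : ℝ} (hlam : 0 ≤ lam) :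
    hCOR (-udMat (a.map ι₂) + lam • P)
      = ((a.card : ℝ) - 1) ^ 2 - 1 + lam * (flat P ⬝ᵥ udPt ((Finset.univ : Finset (Fin k)).map ι₂)) := by
  classical
  set S := (Finset.univ : Finset (Fin k)).map ι₂ with hSdef
  have hval : ∀ b, flat (-udMat (a.map ι₂) + lam • P) ⬝ᵥ udPt b
      = ((1 - ((a.map ι₂ ∩ b).card : ℝ)) ^ 2 - 1) + lam * (flat P ⬝ᵥ udPt b) := by
    intro b
    rw [flat_add₄₁, flat_smul₄₁, add_dotProduct, smul_dotProduct, negUd_dot, smul_eq_mul]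
  apply le_antisymm
  · obtain ⟨b, hb⟩ := exists_eq_hCOR (-udMat (a.map ι₂) + lam • P)
    rw [← hb, hval]
    have h1 := negUd_sq_le ι₂ a ha b
    have h2 : flat P ⬝ᵥ udPt b ≤ flat P ⬝ᵥ udPt S := flat_nonneg_dot_le P S hP0 hPS b
    nlinarith [mul_le_mul_of_nonneg_left h2 hlam]
  · have h := le_hCOR (-udMat (a.map ι₂) + lam • P) S
    have hint : a.map ι₂ ∩ S = a.map ι₂ := Finset.inter_eq_left.mpr (Finset.map_subset_map.mpr (Finset.subset_univ a))
    rw [hval, hint, Finset.card_map] at h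
    have e : ((a.card : ℝ) - 1) ^ 2 = (1 - (a.card : ℝ)) ^ 2 := by ring
    rw [e]
    linarith

/-- ★★★ THE PINNED TWIN BLOCK.  If an entrywise-nonnegative `P` supported in `S × S` (`S = ι₂ univ`) has a UNIQUE maximiser `j⋆` of
`j ↦ ⟨flat P, q_j⟩` over the listed points, then ANY admissible row maxima and ANY nonnegative factorization of the exact-law located slack of
`(COR(n), q)` give `3^{k−2} ≤ (r+1)·2^{k−2}` — rows `(ι₁(a'∪{z₁,z₂}), −udMat(ι₂(a'∪{z₁,z₂})) + λ•P)` with ONE `λ = λ(q, P)`, columns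
`(ι₁ b' ∪ S, j⋆)`. -/
theorem pin_twin_block (ι₁ ι₂ : Fin k ↪ Fin n) (hι : ∀ i j, ι₁ i ≠ ι₂ j) {K r : ℕ} (q : Fin (K + 1) → (Fin (n * n) → ℝ))
    (P : Matrix (Fin n) (Fin n) ℝ) (hP0 : ∀ x y, 0 ≤ P x y)
    (hPS : ∀ x y, P x y ≠ 0 → x ∈ (Finset.univ : Finset (Fin k)).map ι₂ ∧ y ∈ (Finset.univ : Finset (Fin k)).map ι₂)
    (js : Fin (K + 1)) (htop : ∀ j, j ≠ js → flat P ⬝ᵥ q j < flat P ⬝ᵥ q js)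
    {z₁ z₂ : Fin k} (hz : z₁ ≠ z₂)
    (mrow : exactTilted.A n → ℝ) (hm1 : ∀ a j, exactTilted.ρ n a ⬝ᵥ q j ≤ mrow a)
    (hm2 : ∀ a, ∃ j, exactTilted.ρ n a ⬝ᵥ q j = mrow a)
    (U : exactTilted.A n → Option (Fin r) → ℝ) (V : Finset (Fin n) × Fin (K + 1) → Option (Fin r) → ℝ)
    (hU : ∀ a i, 0 ≤ U a i) (hV : ∀ p i, 0 ≤ V p i)
    (hfac : ∀ a b j, (exactTilted.β n a + mrow a) - exactTilted.ρ n a ⬝ᵥ (udPt b + q j) = ∑ i, U a i * V (b, j) i) :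
    3 ^ (k - 2) ≤ (r + 1) * 2 ^ (k - 2) := by
  classical
  set S := (Finset.univ : Finset (Fin k)).map ι₂ with hSdef
  set α : Finset (Fin k) := (Finset.univ.erase z₁).erase z₂ with hαdef
  have hz₂ : z₂ ∈ Finset.univ.erase z₁ := Finset.mem_erase.mpr ⟨hz.symm, Finset.mem_univ _⟩
  have hαcard : α.card = k - 2 := by
    rw [hαdef, Finset.card_erase_of_mem hz₂, Finset.card_erase_of_mem (Finset.mem_univ _), Finset.card_univ, Fintype.card_fin]
    omega
  have hαmem : ∀ x ∈ α, x ≠ z₁ ∧ x ≠ z₂ := fun x hx => by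
    simp only [hαdef, Finset.mem_erase] at hx
    exact ⟨hx.2.1, hx.1⟩
  have hz₁e : ∀ s : Finset ↥α, z₁ ∉ embα α s := fun s h => (hαmem _ (mem_of_mem_embα h)).1 rfl
  have hz₂e : ∀ s : Finset ↥α, z₂ ∉ embα α s := fun s h => (hαmem _ (mem_of_mem_embα h)).2 rfl
  let full : Finset ↥α → Finset (Fin k) := fun a' => insert z₁ (insert z₂ (embα α a'))
  have hfull_card : ∀ a', (full a').card = a'.card + 2 := fun a' => by
    have h1 : z₁ ∉ insert z₂ (embα α a') := fun h => by
      rcases Finset.mem_insert.mp h with h | h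
      · exact hz h
      · exact hz₁e a' h
    show (insert z₁ (insert z₂ (embα α a'))).card = _
    rw [Finset.card_insert_of_notMem h1, Finset.card_insert_of_notMem (hz₂e a'), card_embα]
  have hfull_inter : ∀ a' b' : Finset ↥α, full a' ∩ embα α b' = embα α (a' ∩ b') := fun a' b' => by
    show insert z₁ (insert z₂ (embα α a')) ∩ embα α b' = _
    rw [Finset.insert_inter_of_notMem (hz₁e b'), Finset.insert_inter_of_notMem (hz₂e b'), embα_inter]
  -- the pin strength λ
  let num : Finset ↥α → Fin (K + 1) → ℝ := fun a' j => twinRow ι₁ ι₂ (full a') ⬝ᵥ (q j - q js)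
  let gap : Fin (K + 1) → ℝ := fun j => flat P ⬝ᵥ q js - flat P ⬝ᵥ q j
  have hgap : ∀ j, j ≠ js → 0 < gap j := fun j hj => by
    have := htop j hj
    simp only [gap]
    linarith
  obtain ⟨lam, hlam0, hlam⟩ : ∃ lam : ℝ, 0 ≤ lam ∧ ∀ a' j, j ≠ js → num a' j ≤ lam * gap j := by
    have hne : (Finset.univ : Finset (Finset ↥α × Fin (K + 1))).Nonempty := Finset.univ_nonempty
    let f : Finset ↥α × Fin (K + 1) → ℝ := fun p => max 0 (num p.1 p.2 / gap p.2)
    refine ⟨Finset.univ.sup' hne f, ?_, ?_⟩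
    · exact le_trans (le_max_left 0 (num ∅ js / gap js)) (Finset.le_sup' f (Finset.mem_univ ((∅ : Finset ↥α), js)))
    · intro a' j hj
      have h1 : num a' j / gap j ≤ Finset.univ.sup' hne f :=
        le_trans (le_max_right 0 (num a' j / gap j)) (Finset.le_sup' f (Finset.mem_univ (a', j)))
      rwa [div_le_iff₀ (hgap j hj)] at h1
  -- rows and columns
  let row : Finset ↥α → exactTilted.A n := fun a' => ((full a').map ι₁, -udMat ((full a').map ι₂) + lam • P)
  let colset : Finset ↥α → Finset (Fin n) := fun b' => (embα α b').map ι₁ ∪ S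
  have hρ : ∀ a', exactTilted.ρ n (row a') = twinRow ι₁ ι₂ (full a') + lam • flat P := fun a' => by
    show udRow ((full a').map ι₁) + flat (-udMat ((full a').map ι₂) + lam • P)
      = udRow ((full a').map ι₁) - flat (udMat ((full a').map ι₂)) + lam • flat P
    rw [flat_add₄₁, flat_neg₄₁, flat_smul₄₁]
    abel
  have hβ : ∀ a', exactTilted.β n (row a') = 1 + hCOR (-udMat ((full a').map ι₂) + lam • P) := fun _ => rfl
  -- `j⋆` maximises every pinned row
  have hmaxrow : ∀ a' j, exactTilted.ρ n (row a') ⬝ᵥ q j ≤ exactTilted.ρ n (row a') ⬝ᵥ q js := by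
    intro a' j
    by_cases hj : j = js
    · rw [hj]
    · have h := hlam a' j hj
      simp only [num, gap, dotProduct_sub] at h
      rw [hρ, add_dotProduct, add_dotProduct, smul_dotProduct, smul_dotProduct, smul_eq_mul, smul_eq_mul]
      rw [mul_sub] at h
      linarith
  have hmax : ∀ a', exactTilted.ρ n (row a') ⬝ᵥ q js = mrow (row a') := fun a' => by
    apply le_antisymm (hm1 _ _)
    obtain ⟨j', hj'⟩ := hm2 (row a')
    rw [← hj']
    exact hmaxrow a' j'
  -- the COR part of the located slack on the block is pure
  have hcor : ∀ a' b' : Finset ↥α, exactTilted.β n (row a') - exactTilted.ρ n (row a') ⬝ᵥ udPt (colset b')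
      = (1 - ((a' ∩ b').card : ℝ)) ^ 2 := fun a' b' => by
    have hi1 : (full a').map ι₁ ∩ colset b' = (embα α (a' ∩ b')).map ι₁ := by
      show (full a').map ι₁ ∩ ((embα α b').map ι₁ ∪ (Finset.univ : Finset (Fin k)).map ι₂) = _
      rw [map_inter_col ι₁ ι₂ hι, hfull_inter]
    have hi2 : (full a').map ι₂ ∩ colset b' = (full a').map ι₂ := map_inter_col' ι₁ ι₂ hι _ _
    have hPc : flat P ⬝ᵥ udPt (colset b') = flat P ⬝ᵥ udPt S :=
      flat_supported_dot_eq P S hPS (colset b') Finset.subset_union_right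
    rw [hβ, hCOR_pinTilt ι₂ _ (by rw [hfull_card]; omega) P hP0 hPS hlam0, hρ, add_dotProduct, smul_dotProduct, smul_eq_mul,
      twinRow_dot_udPt, hi1, hi2, hPc, Finset.card_map, Finset.card_map, card_embα, hfull_card]
    push_cast
    ring
  have key := three_pow_le_of_block U V hU hV row (fun b' => (colset b', js)) (fun a' b' => ?_)
  · have h1 : Fintype.card ↥α = k - 2 := by rw [Fintype.card_coe, hαcard]
    have h2 : Fintype.card (Option (Fin r)) = r + 1 := by simp
    rw [h1, h2] at key
    exact key
  · rw [← hfac (row a') (colset b') js, dotProduct_add, hmax a']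
    have := hcor a' b'
    linarith

/-- ★★★★★ **S-TOP PINNING DECIDES** (flat socket): if some entrywise-nonnegative matrix supported in `S × S` (`S = ι₂ univ`, twins covering
all but `≤ 1` point) has a UNIQUE maximiser over the passenger's listed points, then `HasEFOfSize (COR(n) + conv q) r → T c n < r`. -/
theorem sTop_decided (c₀ : ℕ) : ∃ n₀ : ℕ, ∀ n ≥ n₀, ∀ (k : ℕ) (ι₁ ι₂ : Fin k ↪ Fin n), (∀ i j, ι₁ i ≠ ι₂ j) → n ≤ 2 * k + 1 →
    ∀ (K : ℕ) (q : Fin (K + 1) → (Fin (n * n) → ℝ)) (r : ℕ) (P : Matrix (Fin n) (Fin n) ℝ), (∀ x y, 0 ≤ P x y) →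
    (∀ x y, P x y ≠ 0 → x ∈ (Finset.univ : Finset (Fin k)).map ι₂ ∧ y ∈ (Finset.univ : Finset (Fin k)).map ι₂) →
    ∀ js : Fin (K + 1), (∀ j, j ≠ js → flat P ⬝ᵥ q j < flat P ⬝ᵥ q js) →
    HasEFOfSize (corPolytope n + convexHull ℝ (Set.range q)) r → T c₀ n < r := by
  classical
  obtain ⟨n₀, hn₀⟩ := T_lt_of_block_wide c₀
  refine ⟨max n₀ 5, fun n hn k ι₁ ι₂ hι hnk K q r P hP0 hPS js htop hR => ?_⟩
  have hn5 : 5 ≤ n := le_of_max_le_right hn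
  have hk2 : 2 ≤ k := by omega
  refine concl_of_lawBody exactTilted q (fun m hm1 hm2 U V hU hV hfac => ?_) hR
  have hz : (⟨0, by omega⟩ : Fin k) ≠ ⟨1, by omega⟩ := Fin.ne_of_val_ne (by norm_num)
  have hblock := pin_twin_block ι₁ ι₂ hι q P hP0 hPS js htop hz m hm1 hm2 U V hU hV hfac
  exact hn₀ n (le_of_max_le_left hn) (k - 2) r (by omega) hblock

/-! ### §5e (E21⁺) ★★★★★ THE FIBRE FORM — one theorem over §5: a partial common maximiser ON THE TOP FIBRE of a nonneg `S × S` pin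

`TwinPCMOnTop ι₁ ι₂ q P`: for every column set `b` some listed point `q_{j(b)}` is `P`-TOP and, among the `P`-top points (the top FIBRE, on
which the `S × S` block value `⟨P, ·⟩` is frozen), maximises every twin direction `twinRow a` with `|a ∩ b| = 1`.  With the pin `λ·P`, `λ` = the
max ratio over the finitely many (row, non-top point, top point) triples, the point `j(b)` maximises the whole pinned row on the zero cells;
positivity elsewhere is automatic ⇒ junk-tolerant pattern block ⇒ ★★★★★ `sTopFibre_decided`.  SPECIAL CASES: `P = 0` is `TwinPCM` (§5c,
`twinPCMOnTop_zero`), a unique top is `sTop_decided` (§5d, `twinPCMOnTop_of_unique`); NEW: the top fibre may be large provided the twin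
directions have partial common maximisers on it — e.g. the fibre's `U × U`-shadow minus its (frozen) `S × S`-shadow has a point that is
entrywise maximal on the diagonal and minimal off it.  This is the kernel form of the TWIN TRANSFER: C′ on `n` points ⇐ a clique-type common
maximiser problem on the `U × U`-shadow of ONE positive-top fibre, `|U| ≈ n/2`. -/

/-- partial common maximisers of the twin directions ON THE TOP FIBRE of the pin functional `⟨flat P, ·⟩`. -/
def TwinPCMOnTop (ι₁ ι₂ : Fin k ↪ Fin n) {K : ℕ} (q : Fin (K + 1) → (Fin (n * n) → ℝ)) (P : Matrix (Fin n) (Fin n) ℝ) : Prop :=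
  ∀ b : Finset (Fin k), ∃ j : Fin (K + 1), (∀ j', flat P ⬝ᵥ q j' ≤ flat P ⬝ᵥ q j) ∧
    ∀ a : Finset (Fin k), (a ∩ b).card = 1 → ∀ j', flat P ⬝ᵥ q j' = flat P ⬝ᵥ q j → twinRow ι₁ ι₂ a ⬝ᵥ q j' ≤ twinRow ι₁ ι₂ a ⬝ᵥ q j

theorem flat_zero₄₁ : flat (0 : Matrix (Fin n) (Fin n) ℝ) = 0 := by
  funext p; rfl

/-- `P = 0`: the top fibre is everything and `TwinPCMOnTop` is `TwinPCM` (§5c). -/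
theorem twinPCMOnTop_zero (ι₁ ι₂ : Fin k ↪ Fin n) {K : ℕ} (q : Fin (K + 1) → (Fin (n * n) → ℝ)) (hq : TwinPCM ι₁ ι₂ q) :
    TwinPCMOnTop ι₁ ι₂ q 0 := by
  intro b
  obtain ⟨j, hj⟩ := hq b
  refine ⟨j, fun j' => by rw [flat_zero₄₁, zero_dotProduct, zero_dotProduct], fun a hab j' _ => hj a hab j'⟩

/-- a unique top: the fibre is the single point (§5d). -/
theorem twinPCMOnTop_of_unique (ι₁ ι₂ : Fin k ↪ Fin n) {K : ℕ} (q : Fin (K + 1) → (Fin (n * n) → ℝ)) (P : Matrix (Fin n) (Fin n) ℝ)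
    (js : Fin (K + 1)) (htop : ∀ j, j ≠ js → flat P ⬝ᵥ q j < flat P ⬝ᵥ q js) : TwinPCMOnTop ι₁ ι₂ q P := by
  intro b
  refine ⟨js, fun j' => ?_, fun a _ j' hj' => ?_⟩
  · by_cases h : j' = js
    · rw [h]
    · exact le_of_lt (htop j' h)
  · by_cases h : j' = js
    · rw [h]
    · exact absurd hj' (ne_of_lt (htop j' h))

/-- ★★★ THE PINNED TWIN PATTERN BLOCK (fibre form, junk-tolerant). -/
theorem pin_twin_pattern_block (ι₁ ι₂ : Fin k ↪ Fin n) (hι : ∀ i j, ι₁ i ≠ ι₂ j) {K r : ℕ} (q : Fin (K + 1) → (Fin (n * n) → ℝ))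
    (P : Matrix (Fin n) (Fin n) ℝ) (hP0 : ∀ x y, 0 ≤ P x y)
    (hPS : ∀ x y, P x y ≠ 0 → x ∈ (Finset.univ : Finset (Fin k)).map ι₂ ∧ y ∈ (Finset.univ : Finset (Fin k)).map ι₂)
    (hq : TwinPCMOnTop ι₁ ι₂ q P) {z₁ z₂ : Fin k} (hz : z₁ ≠ z₂)
    (mrow : exactTilted.A n → ℝ) (hm1 : ∀ a j, exactTilted.ρ n a ⬝ᵥ q j ≤ mrow a)
    (hm2 : ∀ a, ∃ j, exactTilted.ρ n a ⬝ᵥ q j = mrow a)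
    (U : exactTilted.A n → Option (Fin r) → ℝ) (V : Finset (Fin n) × Fin (K + 1) → Option (Fin r) → ℝ)
    (hU : ∀ a i, 0 ≤ U a i) (hV : ∀ p i, 0 ≤ V p i)
    (hfac : ∀ a b j, (exactTilted.β n a + mrow a) - exactTilted.ρ n a ⬝ᵥ (udPt b + q j) = ∑ i, U a i * V (b, j) i) :
    3 ^ (k - 2) ≤ (r + 1) * 2 ^ (k - 2) := by
  classical
  set S := (Finset.univ : Finset (Fin k)).map ι₂ with hSdef
  set α : Finset (Fin k) := (Finset.univ.erase z₁).erase z₂ with hαdef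
  have hz₂ : z₂ ∈ Finset.univ.erase z₁ := Finset.mem_erase.mpr ⟨hz.symm, Finset.mem_univ _⟩
  have hαcard : α.card = k - 2 := by
    rw [hαdef, Finset.card_erase_of_mem hz₂, Finset.card_erase_of_mem (Finset.mem_univ _), Finset.card_univ, Fintype.card_fin]
    omega
  have hαmem : ∀ x ∈ α, x ≠ z₁ ∧ x ≠ z₂ := fun x hx => by
    simp only [hαdef, Finset.mem_erase] at hx
    exact ⟨hx.2.1, hx.1⟩
  have hz₁e : ∀ s : Finset ↥α, z₁ ∉ embα α s := fun s h => (hαmem _ (mem_of_mem_embα h)).1 rfl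
  have hz₂e : ∀ s : Finset ↥α, z₂ ∉ embα α s := fun s h => (hαmem _ (mem_of_mem_embα h)).2 rfl
  let full : Finset ↥α → Finset (Fin k) := fun a' => insert z₁ (insert z₂ (embα α a'))
  have hfull_card : ∀ a', (full a').card = a'.card + 2 := fun a' => by
    have h1 : z₁ ∉ insert z₂ (embα α a') := fun h => by
      rcases Finset.mem_insert.mp h with h | h
      · exact hz h
      · exact hz₁e a' h
    show (insert z₁ (insert z₂ (embα α a'))).card = _
    rw [Finset.card_insert_of_notMem h1, Finset.card_insert_of_notMem (hz₂e a'), card_embα]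
  have hfull_inter : ∀ a' b' : Finset ↥α, full a' ∩ embα α b' = embα α (a' ∩ b') := fun a' b' => by
    show insert z₁ (insert z₂ (embα α a')) ∩ embα α b' = _
    rw [Finset.insert_inter_of_notMem (hz₁e b'), Finset.insert_inter_of_notMem (hz₂e b'), embα_inter]
  -- the pin strength λ: dominates every (row, lower point, higher point) ratio
  let num : Finset ↥α → Fin (K + 1) → Fin (K + 1) → ℝ := fun a' j j'' => twinRow ι₁ ι₂ (full a') ⬝ᵥ (q j - q j'')
  let gap : Fin (K + 1) → Fin (K + 1) → ℝ := fun j j'' => flat P ⬝ᵥ q j'' - flat P ⬝ᵥ q j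
  obtain ⟨lam, hlam0, hlam⟩ : ∃ lam : ℝ, 0 ≤ lam ∧ ∀ a' j j'', 0 < gap j j'' → num a' j j'' ≤ lam * gap j j'' := by
    have hne : (Finset.univ : Finset (Finset ↥α × Fin (K + 1) × Fin (K + 1))).Nonempty := Finset.univ_nonempty
    let f : Finset ↥α × Fin (K + 1) × Fin (K + 1) → ℝ := fun p => max 0 (num p.1 p.2.1 p.2.2 / gap p.2.1 p.2.2)
    refine ⟨Finset.univ.sup' hne f, ?_, ?_⟩
    · exact le_trans (le_max_left 0 (num ∅ 0 0 / gap 0 0))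
        (Finset.le_sup' f (Finset.mem_univ ((∅ : Finset ↥α), (0 : Fin (K + 1)), (0 : Fin (K + 1)))))
    · intro a' j j'' hg
      have h1 : num a' j j'' / gap j j'' ≤ Finset.univ.sup' hne f :=
        le_trans (le_max_right 0 (num a' j j'' / gap j j'')) (Finset.le_sup' f (Finset.mem_univ (a', j, j'')))
      rwa [div_le_iff₀ hg] at h1
  -- rows, columns, fibre maximisers
  let row : Finset ↥α → exactTilted.A n := fun a' => ((full a').map ι₁, -udMat ((full a').map ι₂) + lam • P)
  let colset : Finset ↥α → Finset (Fin n) := fun b' => (embα α b').map ι₁ ∪ S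
  have hρ : ∀ a', exactTilted.ρ n (row a') = twinRow ι₁ ι₂ (full a') + lam • flat P := fun a' => by
    show udRow ((full a').map ι₁) + flat (-udMat ((full a').map ι₂) + lam • P)
      = udRow ((full a').map ι₁) - flat (udMat ((full a').map ι₂)) + lam • flat P
    rw [flat_add₄₁, flat_neg₄₁, flat_smul₄₁]
    abel
  have hβ : ∀ a', exactTilted.β n (row a') = 1 + hCOR (-udMat ((full a').map ι₂) + lam • P) := fun _ => rfl
  unfold TwinPCMOnTop at hq
  choose jc hjc using hq
  -- on a zero cell the fibre maximiser maximises the whole pinned row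
  have hmaxrow : ∀ a' b' : Finset ↥α, (full a' ∩ embα α b').card = 1 →
      ∀ j, exactTilted.ρ n (row a') ⬝ᵥ q j ≤ exactTilted.ρ n (row a') ⬝ᵥ q (jc (embα α b')) := by
    intro a' b' h1 j
    have htop := (hjc (embα α b')).1 j
    rw [hρ, add_dotProduct, add_dotProduct, smul_dotProduct, smul_dotProduct, smul_eq_mul, smul_eq_mul]
    by_cases hlt : flat P ⬝ᵥ q j < flat P ⬝ᵥ q (jc (embα α b'))
    · have h := hlam a' j (jc (embα α b')) (by simp only [gap]; linarith)
      simp only [num, gap, dotProduct_sub] at h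
      rw [mul_sub] at h
      linarith
    · have heq : flat P ⬝ᵥ q j = flat P ⬝ᵥ q (jc (embα α b')) := le_antisymm htop (not_lt.mp hlt)
      have hfib := (hjc (embα α b')).2 (full a') h1 j heq
      rw [heq]
      linarith
  -- the COR part of the located slack on the block is pure
  have hcor : ∀ a' b' : Finset ↥α, exactTilted.β n (row a') - exactTilted.ρ n (row a') ⬝ᵥ udPt (colset b')
      = (1 - ((a' ∩ b').card : ℝ)) ^ 2 := fun a' b' => by
    have hi1 : (full a').map ι₁ ∩ colset b' = (embα α (a' ∩ b')).map ι₁ := by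
      show (full a').map ι₁ ∩ ((embα α b').map ι₁ ∪ (Finset.univ : Finset (Fin k)).map ι₂) = _
      rw [map_inter_col ι₁ ι₂ hι, hfull_inter]
    have hi2 : (full a').map ι₂ ∩ colset b' = (full a').map ι₂ := map_inter_col' ι₁ ι₂ hι _ _
    have hPc : flat P ⬝ᵥ udPt (colset b') = flat P ⬝ᵥ udPt S :=
      flat_supported_dot_eq P S hPS (colset b') Finset.subset_union_right
    rw [hβ, hCOR_pinTilt ι₂ _ (by rw [hfull_card]; omega) P hP0 hPS hlam0, hρ, add_dotProduct, smul_dotProduct, smul_eq_mul,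
      twinRow_dot_udPt, hi1, hi2, hPc, Finset.card_map, Finset.card_map, card_embα, hfull_card]
    push_cast
    ring
  have key := three_pow_le_of_pattern U V hU hV row (fun b' => (colset b', jc (embα α b'))) (fun a' b' hab => ?_) (fun a' b' hab => ?_)
  · have h1 : Fintype.card ↥α = k - 2 := by rw [Fintype.card_coe, hαcard]
    have h2 : Fintype.card (Option (Fin r)) = r + 1 := by simp
    rw [h1, h2] at key
    exact key
  · have hfull1 : (full a' ∩ embα α b').card = 1 := by rw [hfull_inter, card_embα, hab]
    have hmax : exactTilted.ρ n (row a') ⬝ᵥ q (jc (embα α b')) = mrow (row a') := by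
      apply le_antisymm (hm1 _ _)
      obtain ⟨j', hj'⟩ := hm2 (row a')
      rw [← hj']
      exact hmaxrow a' b' hfull1 j'
    rw [← hfac (row a') (colset b') (jc (embα α b')), dotProduct_add, hmax]
    have := hcor a' b'
    rw [hab] at this
    push_cast at this
    linarith
  · have hab0 : (a' ∩ b').card = 0 := by rw [Finset.disjoint_iff_inter_eq_empty.mp hab, Finset.card_empty]
    rw [← hfac (row a') (colset b') (jc (embα α b')), dotProduct_add]
    have := hcor a' b'
    rw [hab0] at this
    push_cast at this
    have hle := hm1 (row a') (jc (embα α b'))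
    linarith

/-- ★★★★★ **TOP-FIBRE PINNING DECIDES** (flat socket; contains `twinPCM_decided` (`P = 0`) and `sTop_decided` (unique top)). -/
theorem sTopFibre_decided (c₀ : ℕ) : ∃ n₀ : ℕ, ∀ n ≥ n₀, ∀ (k : ℕ) (ι₁ ι₂ : Fin k ↪ Fin n), (∀ i j, ι₁ i ≠ ι₂ j) → n ≤ 2 * k + 1 →
    ∀ (K : ℕ) (q : Fin (K + 1) → (Fin (n * n) → ℝ)) (r : ℕ) (P : Matrix (Fin n) (Fin n) ℝ), (∀ x y, 0 ≤ P x y) →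
    (∀ x y, P x y ≠ 0 → x ∈ (Finset.univ : Finset (Fin k)).map ι₂ ∧ y ∈ (Finset.univ : Finset (Fin k)).map ι₂) →
    TwinPCMOnTop ι₁ ι₂ q P → HasEFOfSize (corPolytope n + convexHull ℝ (Set.range q)) r → T c₀ n < r := by
  classical
  obtain ⟨n₀, hn₀⟩ := T_lt_of_block_wide c₀
  refine ⟨max n₀ 5, fun n hn k ι₁ ι₂ hι hnk K q r P hP0 hPS hq hR => ?_⟩
  have hn5 : 5 ≤ n := le_of_max_le_right hn
  have hk2 : 2 ≤ k := by omega
  refine concl_of_lawBody exactTilted q (fun m hm1 hm2 U V hU hV hfac => ?_) hR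
  have hz : (⟨0, by omega⟩ : Fin k) ≠ ⟨1, by omega⟩ := Fin.ne_of_val_ne (by norm_num)
  have hblock := pin_twin_pattern_block ι₁ ι₂ hι q P hP0 hPS hq hz m hm1 hm2 U V hU hV hfac
  exact hn₀ n (le_of_max_le_left hn) (k - 2) r (by omega) hblock

/-! ### §5f (E21) instances anyone can run by inspection: ONE COORDINATE with a unique maximum decides

The single-entry pin `P = E_{xy}` (`x, y ∈ S`): `⟨flat E_{xy}, flat M⟩ = M x y`.  So: if for some near-half `S` some coordinate `(x, y) ∈ S × S`
attains its maximum over the passenger's listed matrices at a UNIQUE listed matrix, the passenger is decided (`coordTop_decided`).  An enemy's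
vertex list has EVERY coordinate maximum TIED (take `S ∋ x, y`; every pair of points lies in some near-half `S`). -/

/-- the single-entry matrix. -/
def E₁ (x y : Fin n) : Matrix (Fin n) (Fin n) ℝ := fun i m => if i = x ∧ m = y then 1 else 0

theorem flat_E₁_dot_flat (x y : Fin n) (M : Matrix (Fin n) (Fin n) ℝ) : flat (E₁ x y) ⬝ᵥ flat M = M x y := by
  rw [flat_dotProduct_flat]
  simp only [E₁]
  rw [Finset.sum_eq_single x, Finset.sum_eq_single y]
  · simp
  · intro m _ hm; simp [hm]
  · intro h; exact absurd (Finset.mem_univ _) h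
  · intro i _ hi
    apply Finset.sum_eq_zero; intro m _; simp [hi]
  · intro h; exact absurd (Finset.mem_univ _) h

/-- ★★★★ **ONE COORDINATE WITH A UNIQUE MAXIMUM DECIDES** (flat socket, matrix-listed passenger). -/
theorem coordTop_decided (c₀ : ℕ) : ∃ n₀ : ℕ, ∀ n ≥ n₀, ∀ (k : ℕ) (ι₁ ι₂ : Fin k ↪ Fin n), (∀ i j, ι₁ i ≠ ι₂ j) → n ≤ 2 * k + 1 →
    ∀ (K : ℕ) (Qm : Fin (K + 1) → Matrix (Fin n) (Fin n) ℝ) (r : ℕ) (x y : Fin n),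
    x ∈ (Finset.univ : Finset (Fin k)).map ι₂ → y ∈ (Finset.univ : Finset (Fin k)).map ι₂ →
    ∀ js : Fin (K + 1), (∀ j, j ≠ js → Qm j x y < Qm js x y) →
    HasEFOfSize (corPolytope n + convexHull ℝ (Set.range fun j => flat (Qm j))) r → T c₀ n < r := by
  classical
  obtain ⟨n₀, hn₀⟩ := sTop_decided c₀
  refine ⟨n₀, fun n hn k ι₁ ι₂ hι hnk K Qm r x y hx hy js htop hR => ?_⟩
  refine hn₀ n hn k ι₁ ι₂ hι hnk K (fun j => flat (Qm j)) r (E₁ x y) (fun i m => by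
    simp only [E₁]; split_ifs <;> norm_num) (fun i m him => ?_) js (fun j hj => ?_) hR
  · simp only [E₁, ne_eq, ite_eq_right_iff, one_ne_zero, imp_false, not_not] at him
    rw [him.1, him.2]; exact ⟨hx, hy⟩
  · rw [flat_E₁_dot_flat, flat_E₁_dot_flat]; exact htop j hj

end Twin

/-! ### §5g (E21, generic form) — DISTINCT `S`-BLOCKS ARE DECIDED

The genericity step of (E21) in kernel: if the listed passenger points have pairwise distinct `S × S` blocks
(`S = ι₂ (Fin k)`), then the MOMENT PIN `t ^ e(x,y)` on `S × S` (for a suitable real `t > 0` avoiding the finitely many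
roots of the pairwise block polynomials) has a UNIQUE top, so `sTop_decided` applies: the class
«some near-half `S` separates the vertices» is DECIDED by C′ — no functional has to be exhibited. -/

section Generic

variable {n : ℕ}

/-- the exponent code of a matrix position. -/
noncomputable def ecode (n : ℕ) (x y : Fin n) : ℕ := (Fintype.equivFin (Fin n × Fin n) (x, y) : ℕ)

theorem ecode_injective {x y x' y' : Fin n} (h : ecode n x y = ecode n x' y') : x = x' ∧ y = y' := by
  unfold ecode at h
  have h1 := (Fintype.equivFin (Fin n × Fin n)).injective (Fin.ext h)
  simpa [Prod.mk.injEq] using h1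

/-- the MOMENT PIN on `S × S`: weight `t ^ ecode (x, y)`, zero off `S × S`. -/
noncomputable def momPin (S : Finset (Fin n)) (t : ℝ) : Matrix (Fin n) (Fin n) ℝ :=
  fun x y => if x ∈ S ∧ y ∈ S then t ^ ecode n x y else 0

theorem momPin_nonneg (S : Finset (Fin n)) {t : ℝ} (ht : 0 ≤ t) (x y : Fin n) : 0 ≤ momPin S t x y := by
  unfold momPin; split_ifs
  · exact pow_nonneg ht _
  · exact le_rfl

theorem momPin_support (S : Finset (Fin n)) (t : ℝ) (x y : Fin n) (h : momPin S t x y ≠ 0) : x ∈ S ∧ y ∈ S := by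
  unfold momPin at h; by_contra hc; exact h (if_neg hc)

/-- the BLOCK POLYNOMIAL of `Q` on `S`: `∑_{x,y ∈ S} Q x y · X ^ ecode (x, y)`. -/
noncomputable def blockPoly (S : Finset (Fin n)) (Q : Matrix (Fin n) (Fin n) ℝ) : Polynomial ℝ :=
  ∑ x ∈ S, ∑ y ∈ S, Polynomial.C (Q x y) * Polynomial.X ^ ecode n x y

theorem flat_momPin_dot (S : Finset (Fin n)) (t : ℝ) (Q : Matrix (Fin n) (Fin n) ℝ) :
    flat (momPin S t) ⬝ᵥ flat Q = (blockPoly S Q).eval t := by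
  classical
  rw [flat_dotProduct_flat]
  unfold momPin blockPoly
  simp only [Polynomial.eval_finsetSum, Polynomial.eval_mul, Polynomial.eval_C, Polynomial.eval_pow,
    Polynomial.eval_X]
  have key : ∀ i j : Fin n, (if i ∈ S ∧ j ∈ S then t ^ ecode n i j else 0) * Q i j
      = if i ∈ S then (if j ∈ S then Q i j * t ^ ecode n i j else 0) else 0 := by
    intro i j
    by_cases hi : i ∈ S <;> by_cases hj : j ∈ S <;> simp [hi, hj, mul_comm]
  rw [Finset.sum_congr rfl fun i _ => Finset.sum_congr rfl fun j _ => key i j]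
  have inner : ∀ i : Fin n, (∑ j, if j ∈ S then Q i j * t ^ ecode n i j else 0)
      = ∑ j ∈ S, Q i j * t ^ ecode n i j := by
    intro i
    rw [Finset.sum_ite_mem, Finset.univ_inter]
  have outer : (∑ i, if i ∈ S then (∑ j, if j ∈ S then Q i j * t ^ ecode n i j else 0) else 0)
      = ∑ i ∈ S, (∑ j, if j ∈ S then Q i j * t ^ ecode n i j else 0) := by
    rw [Finset.sum_ite_mem, Finset.univ_inter]
  have step : (∑ i, ∑ j, if i ∈ S then (if j ∈ S then Q i j * t ^ ecode n i j else 0) else 0)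
      = ∑ i, if i ∈ S then (∑ j, if j ∈ S then Q i j * t ^ ecode n i j else 0) else 0 := by
    refine Finset.sum_congr rfl fun i _ => ?_
    by_cases hi : i ∈ S
    · simp [hi]
    · simp [hi]
  rw [step, outer]
  exact Finset.sum_congr rfl fun i _ => inner i

theorem blockPoly_sub (S : Finset (Fin n)) (Q Q' : Matrix (Fin n) (Fin n) ℝ) :
    blockPoly S (Q - Q') = blockPoly S Q - blockPoly S Q' := by
  unfold blockPoly
  simp only [Matrix.sub_apply, Polynomial.C_sub, sub_mul, Finset.sum_sub_distrib]

theorem blockPoly_coeff (S : Finset (Fin n)) (Q : Matrix (Fin n) (Fin n) ℝ) {x₀ y₀ : Fin n}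
    (hx : x₀ ∈ S) (hy : y₀ ∈ S) : (blockPoly S Q).coeff (ecode n x₀ y₀) = Q x₀ y₀ := by
  classical
  unfold blockPoly
  simp only [Polynomial.finsetSum_coeff, Polynomial.coeff_C_mul_X_pow]
  rw [Finset.sum_eq_single x₀]
  · rw [Finset.sum_eq_single y₀]
    · simp
    · intro y _ hyy
      rw [if_neg]
      intro h; exact hyy (ecode_injective h).2.symm
    · intro h; exact absurd hy h
  · intro x _ hxx
    refine Finset.sum_eq_zero fun y _ => ?_
    rw [if_neg]
    intro h; exact hxx (ecode_injective h).1.symm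
  · intro h; exact absurd hx h

theorem blockPoly_ne_zero (S : Finset (Fin n)) (D : Matrix (Fin n) (Fin n) ℝ) {x₀ y₀ : Fin n}
    (hx : x₀ ∈ S) (hy : y₀ ∈ S) (hD : D x₀ y₀ ≠ 0) : blockPoly S D ≠ 0 := by
  intro h
  have := blockPoly_coeff S D hx hy
  rw [h, Polynomial.coeff_zero] at this
  exact hD this.symm

/-- ★ GENERICITY: pairwise distinct `S × S` blocks ⇒ a nonneg pin supported on `S × S` separating ALL listed points
(hence with a unique top). The pin is the moment pin at `t = 1 + ∑ |roots|`. -/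
theorem exists_separating_pin (S : Finset (Fin n)) {K : ℕ} (Qm : Fin (K + 1) → Matrix (Fin n) (Fin n) ℝ)
    (hdis : ∀ j j', j ≠ j' → ∃ x ∈ S, ∃ y ∈ S, Qm j x y ≠ Qm j' x y) :
    ∃ P : Matrix (Fin n) (Fin n) ℝ, (∀ x y, 0 ≤ P x y) ∧ (∀ x y, P x y ≠ 0 → x ∈ S ∧ y ∈ S) ∧
      Function.Injective (fun j => flat P ⬝ᵥ flat (Qm j)) := by
  classical
  -- the finite set of bad parameters
  let B : Finset ℝ := (Finset.univ : Finset (Fin (K + 1) × Fin (K + 1))).biUnion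
    (fun jj => (blockPoly S (Qm jj.1 - Qm jj.2)).roots.toFinset)
  let t : ℝ := 1 + ∑ b ∈ B, |b|
  have hBsum : 0 ≤ ∑ b ∈ B, |b| := Finset.sum_nonneg fun b _ => abs_nonneg b
  have ht0 : 0 < t := by positivity
  have htB : t ∉ B := by
    intro htB
    have h1 : |t| ≤ ∑ b ∈ B, |b| := Finset.single_le_sum (fun b _ => abs_nonneg b) htB
    rw [abs_of_pos ht0] at h1
    linarith
  refine ⟨momPin S t, momPin_nonneg S ht0.le, momPin_support S t, ?_⟩
  intro j j' hjj
  by_contra hne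
  obtain ⟨x, hx, y, hy, hD⟩ := hdis j j' hne
  have hp0 : blockPoly S (Qm j - Qm j') ≠ 0 :=
    blockPoly_ne_zero S (Qm j - Qm j') hx hy (by simpa [Matrix.sub_apply, sub_eq_zero] using hD)
  have hroot : (blockPoly S (Qm j - Qm j')).IsRoot t := by
    rw [Polynomial.IsRoot.def, blockPoly_sub, Polynomial.eval_sub, ← flat_momPin_dot, ← flat_momPin_dot]
    have : flat (momPin S t) ⬝ᵥ flat (Qm j) = flat (momPin S t) ⬝ᵥ flat (Qm j') := by simpa using hjj
    rw [this, sub_self]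
  apply htB
  rw [Finset.mem_biUnion]
  exact ⟨(j, j'), Finset.mem_univ _, by rw [Multiset.mem_toFinset]; exact (Polynomial.mem_roots hp0).2 hroot⟩

/-- ★★★★★ (E21, GENERIC FORM) DISTINCT `S`-BLOCKS ARE DECIDED: if for the twin half `S = ι₂ (Fin k)` the listed passenger
points have pairwise distinct `S × S` blocks, the passenger is decided by C′ (block `k − 2`, so for `n ≤ 2k + 1` the
budget is beaten for `n ≥ n₀`). In particular a passenger is an ENEMY of C′ only if, for EVERY near-half `S`, two of its
listed points agree on `S × S`. -/
theorem distinctS_decided (c₀ : ℕ) : ∃ n₀ : ℕ, ∀ n ≥ n₀, ∀ (k : ℕ) (ι₁ ι₂ : Fin k ↪ Fin n), (∀ i j, ι₁ i ≠ ι₂ j) →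
    n ≤ 2 * k + 1 → ∀ (K : ℕ) (Qm : Fin (K + 1) → Matrix (Fin n) (Fin n) ℝ) (r : ℕ),
    (∀ j j', j ≠ j' → ∃ x ∈ (Finset.univ : Finset (Fin k)).map ι₂, ∃ y ∈ (Finset.univ : Finset (Fin k)).map ι₂,
      Qm j x y ≠ Qm j' x y) →
    HasEFOfSize (corPolytope n + convexHull ℝ (Set.range fun j => flat (Qm j))) r → T c₀ n < r := by
  classical
  obtain ⟨n₀, hn₀⟩ := sTop_decided c₀
  refine ⟨n₀, fun n hn k ι₁ ι₂ hι hnk K Qm r hdis hR => ?_⟩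
  obtain ⟨P, hP0, hPS, hinj⟩ := exists_separating_pin ((Finset.univ : Finset (Fin k)).map ι₂) Qm hdis
  obtain ⟨js, -, hjs⟩ := Finset.exists_max_image (Finset.univ : Finset (Fin (K + 1)))
    (fun j => flat P ⬝ᵥ flat (Qm j)) ⟨0, Finset.mem_univ _⟩
  refine hn₀ n hn k ι₁ ι₂ hι hnk K (fun j => flat (Qm j)) r P hP0 hPS js (fun j hj => ?_) hR
  exact lt_of_le_of_ne (hjs j (Finset.mem_univ _)) (fun h => hj (hinj h))

end Generic

/-! ### §5h (g4, pen 01:25:19Z (2) / crit-9 V#101b) ★ SPECIES TEN ⊆ CLASS P: a nonneg `S × S` pin with a unique top is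
`LocatedRows.PinExposed` data — the λ-scaled pin

Census bookkeeping for the line's residual: the s-top species (`sTop_decided`, §5d) and the generic species TEN (`distinctS_decided`, §5g)
are MEMBERS of the landed class `LocatedRows.PinExposed` (`Theorems/…LocatedRowsPinExposed.lean`), hence inside `PinLocated` of the cone
X₁₈ — no new disjunct.  Pin data: `(S, flat (c • P), j⋆)` with `c = Σ_j Σ_a |udRow a ⬝ (q_j − q_{j⋆})| / gap_j` (any `c` dominating the
finitely many tilt/gap ratios works): VALID on `COR(n)` (`flat_le_hCOR`, `exists_eq_hCOR`, `flat_nonneg_dot_le`), TIGHT-UP on `b ⊇ S`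
(`flat_supported_dot_eq`), and `j⋆` maximises every row `udRow a + c·flat P` because `c·gap_j` dominates the clique-part difference. -/

section TenPinned
variable {n : ℕ}

/-- ★ s-top data are pin-exposed data (TEN's lever ⊆ CLASS P): a nonnegative `P` supported on `S × S`, `2|S| ≤ n`, whose functional
`⟨flat P, ·⟩` has a STRICT unique top `j⋆` among the listed points, yields `LocatedRows.PinExposed n K q` with the pin `flat (c • P)`. -/
theorem sTop_pinExposed {K : ℕ} (q : Fin (K + 1) → (Fin (n * n) → ℝ)) (S : Finset (Fin n)) (hS : 2 * S.card ≤ n)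
    (P : Matrix (Fin n) (Fin n) ℝ) (hP0 : ∀ x y, 0 ≤ P x y) (hPS : ∀ x y, P x y ≠ 0 → x ∈ S ∧ y ∈ S)
    (js : Fin (K + 1)) (htop : ∀ j, j ≠ js → flat P ⬝ᵥ q j < flat P ⬝ᵥ q js) : PinExposed n K q := by
  classical
  -- the gaps (dummy value `1` at `j⋆`) and the dominating constant
  let gap : Fin (K + 1) → ℝ := fun j => if j = js then 1 else flat P ⬝ᵥ q js - flat P ⬝ᵥ q j
  have hgap_pos : ∀ j, 0 < gap j := by
    intro j
    by_cases hj : j = js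
    · simp [gap, hj]
    · have := htop j hj
      simp only [gap, if_neg hj]
      linarith
  have hgap_of_ne : ∀ j, j ≠ js → gap j = flat P ⬝ᵥ q js - flat P ⬝ᵥ q j := fun j hj => by simp [gap, hj]
  let c : ℝ := ∑ j, ∑ a : Finset (Fin n), |udRow a ⬝ᵥ q j - udRow a ⬝ᵥ q js| / gap j
  have hc0 : 0 ≤ c :=
    Finset.sum_nonneg fun j _ => Finset.sum_nonneg fun a _ => div_nonneg (abs_nonneg _) (hgap_pos j).le
  have hkey : ∀ (a : Finset (Fin n)) (j : Fin (K + 1)), j ≠ js →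
      udRow a ⬝ᵥ q j - udRow a ⬝ᵥ q js ≤ c * (flat P ⬝ᵥ q js - flat P ⬝ᵥ q j) := by
    intro a j hj
    have hg := hgap_of_ne j hj
    have hgp : 0 < flat P ⬝ᵥ q js - flat P ⬝ᵥ q j := by rw [← hg]; exact hgap_pos j
    have h1 : |udRow a ⬝ᵥ q j - udRow a ⬝ᵥ q js| / gap j ≤ c := by
      calc |udRow a ⬝ᵥ q j - udRow a ⬝ᵥ q js| / gap j
          ≤ ∑ a' : Finset (Fin n), |udRow a' ⬝ᵥ q j - udRow a' ⬝ᵥ q js| / gap j :=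
            Finset.single_le_sum (f := fun a' : Finset (Fin n) => |udRow a' ⬝ᵥ q j - udRow a' ⬝ᵥ q js| / gap j)
              (fun a' _ => div_nonneg (abs_nonneg _) (hgap_pos j).le) (Finset.mem_univ a)
        _ ≤ c := Finset.single_le_sum (f := fun j' : Fin (K + 1) =>
              ∑ a' : Finset (Fin n), |udRow a' ⬝ᵥ q j' - udRow a' ⬝ᵥ q js| / gap j')
              (fun j' _ => Finset.sum_nonneg fun a' _ => div_nonneg (abs_nonneg _) (hgap_pos j').le) (Finset.mem_univ j)
    rw [hg] at h1
    calc udRow a ⬝ᵥ q j - udRow a ⬝ᵥ q js ≤ |udRow a ⬝ᵥ q j - udRow a ⬝ᵥ q js| := le_abs_self _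
      _ = |udRow a ⬝ᵥ q j - udRow a ⬝ᵥ q js| / (flat P ⬝ᵥ q js - flat P ⬝ᵥ q j) * (flat P ⬝ᵥ q js - flat P ⬝ᵥ q j) := by
          field_simp
      _ ≤ c * (flat P ⬝ᵥ q js - flat P ⬝ᵥ q j) := mul_le_mul_of_nonneg_right h1 hgp.le
  -- the scaled pin
  have hcP0 : ∀ x y, 0 ≤ (c • P) x y := fun x y => by
    simpa [Matrix.smul_apply, smul_eq_mul] using mul_nonneg hc0 (hP0 x y)
  have hcPS : ∀ x y, (c • P) x y ≠ 0 → x ∈ S ∧ y ∈ S := fun x y h => hPS x y fun h0 => h (by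
    simp [Matrix.smul_apply, h0])
  have hsm : flat (c • P) = c • flat P := by
    funext p
    simp [flat, Matrix.smul_apply, smul_eq_mul]
  refine ⟨S, flat (c • P), js, hS, ?_, ?_, ?_⟩
  · -- VALID on `COR(n)`
    intro x hx
    obtain ⟨b, hb⟩ := exists_eq_hCOR (c • P)
    have h1 := flat_le_hCOR (c • P) x hx
    rw [← hb] at h1
    exact h1.trans (flat_nonneg_dot_le (c • P) S hcP0 hcPS b)
  · -- TIGHT-UP on columns `b ⊇ S`
    intro b hb
    exact flat_supported_dot_eq (c • P) S hcPS b hb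
  · -- `j⋆` maximises every pinned row (for ALL `a`, not only `a ⊆ Sᶜ`)
    intro a _ j
    by_cases hj : j = js
    · rw [hj]
    · have hk := hkey a j hj
      rw [hsm, add_dotProduct, add_dotProduct, smul_dotProduct, smul_dotProduct, smul_eq_mul, smul_eq_mul]
      nlinarith [hk, mul_sub c (flat P ⬝ᵥ q js) (flat P ⬝ᵥ q j)]

/-- ★ SPECIES TEN ⊆ CLASS P: on a twin frame (`ι₁, ι₂ : Fin k ↪ Fin n` with disjoint images, so `2k ≤ n`), pairwise distinct
`S × S` blocks of the listed points (`S = ι₂[Fin k]`) give `LocatedRows.PinExposed` — via the separating moment pin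
(`exists_separating_pin`) and `sTop_pinExposed`.  (So `distinctS_decided` is also a corollary of the landed `pinExposed_decided` /
`exactTilted_law_on_pinExposed`, up to the block-size bookkeeping.) -/
theorem distinctS_pinExposed {k : ℕ} (ι₁ ι₂ : Fin k ↪ Fin n) (hι : ∀ i j, ι₁ i ≠ ι₂ j) {K : ℕ}
    (Qm : Fin (K + 1) → Matrix (Fin n) (Fin n) ℝ)
    (hdis : ∀ j j', j ≠ j' → ∃ x ∈ (Finset.univ : Finset (Fin k)).map ι₂, ∃ y ∈ (Finset.univ : Finset (Fin k)).map ι₂,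
      Qm j x y ≠ Qm j' x y) :
    PinExposed n K (fun j => flat (Qm j)) := by
  classical
  obtain ⟨P, hP0, hPS, hinj⟩ := exists_separating_pin ((Finset.univ : Finset (Fin k)).map ι₂) Qm hdis
  obtain ⟨js, -, hjs⟩ := Finset.exists_max_image (Finset.univ : Finset (Fin (K + 1)))
    (fun j => flat P ⬝ᵥ flat (Qm j)) ⟨0, Finset.mem_univ _⟩
  have h2k : 2 * ((Finset.univ : Finset (Fin k)).map ι₂).card ≤ n := by
    rw [Finset.card_map, Finset.card_univ, Fintype.card_fin]
    have hdisj : Disjoint ((Finset.univ : Finset (Fin k)).map ι₁) ((Finset.univ : Finset (Fin k)).map ι₂) := by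
      rw [Finset.disjoint_left]
      intro x hx₁ hx₂
      rw [Finset.mem_map] at hx₁ hx₂
      obtain ⟨i, -, rfl⟩ := hx₁
      obtain ⟨j, -, hj⟩ := hx₂
      exact hι i j hj.symm
    have hcard := Finset.card_le_univ (((Finset.univ : Finset (Fin k)).map ι₁) ∪ ((Finset.univ : Finset (Fin k)).map ι₂))
    rw [Finset.card_union_of_disjoint hdisj, Finset.card_map, Finset.card_map, Finset.card_univ, Fintype.card_fin,
      Fintype.card_fin] at hcard
    omega
  exact sTop_pinExposed (fun j => flat (Qm j)) _ h2k P hP0 hPS js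
    (fun j hj => lt_of_le_of_ne (hjs j (Finset.mem_univ _)) (fun h => hj (hinj h)))

end TenPinned

end Summit.ValiantsHypothesis.ValiantsHypothesis.Cruxes.NNDivisionHard.ValIdea41.ShadowConstRead
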